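import Literature.NumberTheory.EllipticCurves.HeegnerPointsKolyvaginProofs
import Literature.NumberTheory.EllipticCurves.HeegnerPointReflectionHolds
import Literature.NumberTheory.EllipticCurves.BSDHeegnerPointsGrossZagierProofs
import Literature.NumberTheory.EllipticCurves.BSDQuadraticDescentShaOddPartProofs
import Literature.NumberTheory.EllipticCurves.IwasawaLeadingTermProofs
import Literature.NumberTheory.EllipticCurves.ComplexMultiplicationHasCMProofs
import Literature.NumberTheory.EllipticCurves.ComplexMultiplication
import HarnessLib

/-!
# Kolyvagin's Theorem A over `ℚ(i)` and `ℚ(√-3)` for `E` without CM: reduction to the main case by quadratic twists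

Fourth sibling *proofs* file (theorems only, no definitions, no named facts) of
`Literature.NumberTheory.EllipticCurves.HeegnerPointsKolyvaginProofs` for the leaf
`Literature.NumberTheory.EllipticCurves.Kolyvagin1990_thmA_of_hasCM_or_discr N W K` — Kolyvagin's
Theorem A (*"Suppose `y_K` has infinite order. Then `E(K)` has rank `1` and `Ш(E/K)` is
finite"*, McCallum 1991, §1; Gross 1991, Thm. 1.3 = [K1, Thm. A]) in the two cases Gross's
exposition sets aside: `E` with complex multiplication (§2), or `d_K ∈ {-3, -4}` (§1: *"for
simplicity, we assume that `D ≠ 3, 4`, so the integers `𝒪` of `K` have unit group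
`𝒪^× = ⟨±1⟩`"*). The sibling files `…ExceptionalProofs`, `…ExceptionalSelmerProofs`,
`…ExceptionalPrimaryProofs` reduce the leaf to the per-prime Euler-system statements of Gross
§§3–8 / McCallum §§4–5 transplanted to these cases, for which no printed proof is held ([K1] is
cite-only). This file shows that **for `E` without CM nothing beyond the main case is needed**: the
case `d_K ∈ {-3, -4}` of Theorem A follows from Theorem A for *other* imaginary quadratic fields
(with `𝒪^× = {±1}`), Gross–Zagier and the non-vanishing theorems for quadratic twists, by the
descent of rank and `Ш` along `K/ℚ`. Only the CM half of the leaf still needs Kolyvagin's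
argument outside Gross's standing hypotheses.

## The argument (all glue proved here or in the tree)

Let `E/ℚ` be non-CM, `K = ℚ(√d_K)` imaginary quadratic with the Heegner hypothesis for `N`, and
`y_K = P ∈ E(K)` a Heegner point of level `N` of infinite order.
1. *Gross–Zagier at `(N, E, K)`* (`gross_zagier`, every fundamental `d_K`: Gross–Zagier 1986,
   Thm. I.6.3, and Cai–Shu–Tian 2014, Thm. 1.1): `L'(E/K, 1) = κ ĥ(P)` with `κ > 0`
   (`maninConstant_ne_zero_holds`) and `ĥ(P) ≠ 0` (`canonicalHeight_eq_zero_iff_holds`), so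
   `L'(E/K, 1) ≠ 0`; as `L(E/K, s) = L(E, s) L(E^{(d_K)}, s)` is entire (modularity),
   `ord L(E) + ord L(E^{(d_K)}) = ord L(E/K) ≤ 1`
   (`analyticRank_add_le_one_of_isHeegnerPoint_of_not_isOfFinAddOrder`).
2. *bsd.S17 for `E` and for `E^{(d_K)}` from the MAIN CASE of Theorem A.* Both curves are non-CM
   (`HasCM` depends only on `j`: `hasCM_iff_of_j_eq`, `j_quadraticTwist`). Darmon's proof of
   Thm. 3.22 (§3.9; in the tree `rank_eq_analyticRank_of_isGloballyMinimal_of_heegnerPoint` of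
   `LeadingTermHeegnerProofs`) is re-run with the auxiliary Heegner field `K'` chosen with
   `|d_{K'}| > 4` — the bound is part of the printed non-vanishing theorems ("infinitely many `D`")
   and of the tree's `waldspurger_exists_heegnerField_twist_ne_zero`,
   `murtyMurty_exists_heegnerField_twist_simpleZero` — so Kolyvagin's theorem is invoked only at
   instances `(N_{E'}, E', K')` with `E'` non-CM and `d_{K'} ∉ {-3, -4}`
   (`rank_eq_analyticRank_of_isGloballyMinimal_of_not_hasCM_of_mainCase`,
   `rank_eq_analyticRank_of_not_hasCM_of_mainCase`); Prop. 3.11 is the tree's theorem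
   `heegnerPoint_conj_add_rootNumber_smul_holds`. Hence `rank E'(ℚ) = ord L(E')` and `Ш(E'/ℚ)` is
   finite for `E' = E, E^{(d_K)}`.
3. *Rank.* `rank E(K) = rank E(ℚ) + rank E^{(d_K)}(ℚ) ≤ 1` (Silverman, *AEC*, Exercise 10.16:
   `mordellWeilRank_baseChange_quadratic_holds`), and `rank E(K) ≥ 1` from `y_K` (Mordell–Weil,
   `module_finite_point_holds`).
4. *`Ш(E/K)` is finite* (§A, `shaFinite_baseChange_of_shaFinite`, proved for every elliptic `E/ℚ`
   and quadratic `K`): every `Ш(E/K)[p^∞]` is finite since its corank is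
   `corank Ш(E/ℚ)[p^∞] + corank Ш(E^{(d_K)}/ℚ)[p^∞] = 0` by the proved corank identities
   (`selmerCorank_baseChange_quadratic_holds`, T. Dokchitser 2013 §4 after Dokchitser–Dokchitser
   2010, Lemma 4.14; `selmerCorank_eq_mordellWeilRank_add_holds`, Greenberg 1999 §1; the rank
   identity), and for odd `p` with `Ш(E/ℚ)[p^∞] = Ш(E^{(c)}/ℚ)[p^∞] = 0` (`K = ℚ(√c)`,
   `E^{(c)} ≅ E^{(d_K)}`; all but finitely many `p`) the comparison isomorphism
   `Sel_{p^∞}(E/ℚ) × Sel_{p^∞}(E^{(c)}/ℚ) ≅ Sel_{p^∞}(E/K)` (`comparisonMap_bijective_of_odd`) makes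
   `Sel_{p^∞}(E/K)` `p`-divisible (both factors are images of `E'(ℚ) ⊗ ℚ_p/ℤ_p`, Greenberg's
   Kummer sequence `range_kummerMapPInfty`), hence its finite image `Ш(E/K)[p^∞]` is
   `p`-divisible, hence zero; conclude by `shaFinite_of_primary`.

## Main results

* `shaFinite_baseChange_of_shaFinite` — `Ш(E/ℚ)`, `Ш(E^{(d_K)}/ℚ)` finite `⇒ Ш(E/K)` finite
  (`[K : ℚ] = 2`), unconditionally; converse of the tree's `shaFinite_of_baseChange` /
  `shaFinite_quadraticTwist_of_shaFinite_baseChange` (Milne 1972, §1, Thm. 1 in substance).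
* `rank_eq_analyticRank_of_thmA_on` — bsd.S17 for the curves of a class `C` (stable under changes
  of variables) from Theorem A for `C` over fields with `d ∉ {-3, -4}` (+ the named facts of
  Darmon's proof); specialisations `rank_eq_analyticRank_of_not_hasCM_of_mainCase` (`C` = non-CM:
  the main case) and `rank_eq_analyticRank_of_thmA_discr_ne` (`C` = all curves).
* `mordellWeilRank_eq_one_and_shaFinite_of_thmA_on` — Theorem A over ANY imaginary quadratic `K`
  for `E ∈ C` (`C` stable under changes of variables and twists) from Theorem A for `C`,
  `d ∉ {-3, -4}`: the twist route. Specialisations: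
  `Kolyvagin1990_thmA_of_hasCM_or_discr_of_not_hasCM_of_mainCase` — **the non-CM half of the
  leaf** from `kolyvagin` at main-case instances, modularity, Waldspurger, Murty–Murty,
  Gross–Zagier and the `K`-rationality of Heegner points;
  `Kolyvagin1990_thmA_of_hasCM_or_discr_of_thmA_discr_ne`, `kolyvagin_of_thmA_discr_ne` — the
  whole leaf, resp. `kolyvagin` everywhere, from `kolyvagin` at instances with `d ∉ {-3, -4}`:
  **Gross's "for simplicity `D ≠ 3, 4`" costs nothing**;
  `Kolyvagin1990_thmA_of_hasCM_or_discr_of_mainCase_of_hasCM_discr_ne` — the leaf from the main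
  case plus Theorem A for CM curves over fields with `d ∉ {-3, -4}`;
  `Kolyvagin1990_thmA_of_hasCM_or_discr_of_not_hasCM_of_Gross1991` — the non-CM half down to
  Gross's leaves `Gross1991_prop_2_1`, `serre_open_image`, `Kolyvagin1990_sha_primary_finite`, the
  last **at main-case instances only** (so no cycle with
  `HeegnerPointsKolyvaginPrimaryLeavesProofs`, which feeds the CM / `d_K ∈ {-3, -4}` instances of
  that leaf from the present one); `kolyvagin_of_not_hasCM_of_mainCase` — `kolyvagin N W K` for
  non-CM `E` and every `K`; `Kolyvagin1990_thmA_of_hasCM_or_discr_of_mainCase_of_hasCM` — the leaf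
  from its two halves.

* §E, the CM half: `rank_eq_analyticRank_of_hasCM_of_thmA_cm_rankOne` — bsd.S17 for CM curves
  from Coates–Wiles 1977 + Rubin 1987 in analytic rank `0` (tree facts
  `finite_point_of_hasCM_of_L_one_ne_zero`, `shaFinite_of_hasCM_of_L_one_ne_zero`) and Theorem A
  only for CM curves of analytic rank `1` over Waldspurger fields with `d ∉ {-3, -4}`;
  `Kolyvagin1990_thmA_of_hasCM_or_discr_of_hasCM_of_thmA_cm_rankOne` — the CM half of the leaf
  from these; `Kolyvagin1990_thmA_of_hasCM_or_discr_of_mainCase_of_thmA_cm_rankOne` — **the whole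
  leaf from the main case, Coates–Wiles–Rubin, the analytic named facts, and Theorem A for CM
  curves `E'` of analytic rank `1` over `K'` with `d_{K'} ∉ {-3, -4}`, `L(E'^{(d_{K'})}, 1) ≠ 0`**.

* §F: `kolyvagin_of_mainCase_of_thmA_cm_rankOne` and
  `rank_eq_analyticRank_of_analyticRank_le_one_of_mainCase_of_thmA_cm_rankOne` — `kolyvagin` at
  every instance (`K : Type`), resp. bsd.S17, from the same inputs.

What remains of the leaf after this file is exactly that last input (hypothesis `hKo1`):
Kolyvagin's theorem for CM curves in the configuration of his original theorem
(`ord L(E'/K') = 1`, `𝒪_{K'}^× = {±1}`), i.e. the data `h` of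
`Kolyvagin1990_thmA_of_hasCM_or_discr_of_localDataM` (`…ExceptionalPrimaryProofs`) for CM curves of
analytic rank `1` and `d_K ∉ {-3, -4}` only.

## Design notes

* Fields `K : Type` (universe `0`), as in the consumers of `kolyvagin` (the bsd.S17 assemblies of
  `LeadingTermHeegnerProofs`, `HeegnerPointReflectionHolds`) and in the Selmer comparison
  (`comparisonMap`, `selmerCorank_baseChange_quadratic`), whose auxiliary fields come from
  `waldspurger_…` / `murtyMurty_…` in `Type`.
* Kernel-reviewed sibling: imports the statement file and proved tree files only; the heavy import
  `IwasawaLeadingTermProofs` is used for `finite_primaryComponent_sha_iff_shaCorank_eq_zero`.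

## References

* [McCallumLMS1991] W. G. McCallum, *Kolyvagin's work on Shafarevich–Tate groups*, LMS LN 153
  (1991), §1 (Theorem (Kolyvagin), no CM or `D ≠ 3, 4` restriction).
* [GrossLMS1991] B. H. Gross, *Kolyvagin's work on modular elliptic curves*, LMS LN 153 (1991),
  §1 (Thm. 1.3, "for simplicity `D ≠ 3, 4`"), §2 (non-CM, Prop. 2.1).
* [Darmon2004] H. Darmon, *Rational Points on Modular Elliptic Curves*, CBMS 101 (2004), Thm. 3.22
  and its proof, §3.9; Prop. 3.11.
* B. H. Gross, D. B. Zagier, Invent. Math. 84 (1986), Thm. I.6.3, I.§7; L. Cai, J. Shu, Y. Tian,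
  Algebra Number Theory 8 (2014), Thm. 1.1.
* [DokchitserDokchitserAnnals2010] T. Dokchitser, V. Dokchitser, Ann. of Math. 172 (2010),
  Lemma 4.14; [Dokchitser2013ParityNotes] T. Dokchitser, *Notes on the parity conjecture* (2013), §4.
* [Greenberg1999LNM] R. Greenberg, *Iwasawa theory for elliptic curves*, LNM 1716 (1999), §§1–2.
* [Milne1972ArithmeticAV] J. S. Milne, *On the arithmetic of abelian varieties*, Invent. Math. 17
  (1972), §1, Thm. 1.
* [SilvermanAEC2009] J. H. Silverman, *The Arithmetic of Elliptic Curves*, 2nd ed., Exercise 10.16.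
* [CoatesWiles1977] J. Coates, A. Wiles, *On the conjecture of Birch and Swinnerton-Dyer*, Invent.
  Math. 39 (1977), Thm. 1; [Rubin1987Sha] K. Rubin, *Tate–Shafarevich groups and `L`-functions of
  elliptic curves with complex multiplication*, Invent. Math. 89 (1987), Thm. A and §0 Remark (3).
-/

noncomputable section

open scoped Classical

open WeierstrassCurve NumberField Literature.NumberTheory.QuadraticFields

universe u

namespace Literature.NumberTheory.EllipticCurves

/-! ## §A. Finiteness of `Ш(E/K)` from `Ш(E/ℚ)` and `Ш(E^{(d_K)}/ℚ)` for a quadratic field `K` -/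

section ShaDescent

/-- **`Sel_{p^∞}(E/F)` is `p`-divisible when `Ш(E/F)[p^∞] = 0`.** Then `Sel_{p^∞}(E/F)` is the
image of the `p^∞` Kummer map `κ : E(F) ⊗ ℚ_p/ℤ_p → H¹(F, E[p^∞])` (exactness of
`0 → E(F) ⊗ ℚ_p/ℤ_p → Sel_{p^∞}(E/F) → Ш(E/F)[p^∞] → 0`, the tree's `range_kummerMapPInfty` and
`map_primaryH1ToH1_selmerGroupPInfty`), and `E(F) ⊗ ℚ_p/ℤ_p` is `p`-divisible
(`tensorPrufer_divisible`). Greenberg, LNM 1716 (1999), §2, pp. 62–63. [folklore] -/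
theorem exists_nsmul_eq_of_primaryComponent_sha_eq_bot {F : Type u} [Field F] [NumberField F]
    (X : WeierstrassCurve F) [X.IsElliptic] (p : ℕ) [Fact p.Prime]
    (h : AddCommGroup.primaryComponent X.sha p = ⊥) (s : selmerGroupPInfty X p) :
    ∃ s' : selmerGroupPInfty X p, p • s' = s := by
  have hdiv : X.zsmul_geomPoints_surjective := X.zsmul_geomPoints_surjective_holds
  have hmap := X.map_primaryH1ToH1_selmerGroupPInfty p hdiv
  rw [h, AddSubgroup.map_bot] at hmap
  -- `s` dies in `H¹(F, E)`, so it comes from `E(F) ⊗ ℚ_p/ℤ_p`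
  have hs0 : X.primaryH1ToH1 p (s : galH1Primary X p) ∈
      (selmerGroupPInfty X p).map (X.primaryH1ToH1 p) := ⟨s, s.2, rfl⟩
  rw [hmap, AddSubgroup.mem_bot] at hs0
  have hker : (s : galH1Primary X p) ∈ (X.primaryH1ToH1 p).ker := hs0
  rw [← X.range_kummerMapPInfty p hdiv] at hker
  obtain ⟨t, ht⟩ := hker
  obtain ⟨t', rfl⟩ := tensorPrufer_divisible p _ t
  have hmem : X.kummerMapPInfty p hdiv t' ∈ selmerGroupPInfty X p :=
    X.ker_primaryH1ToH1_le_selmerGroupPInfty p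
      (by rw [← X.range_kummerMapPInfty p hdiv]; exact ⟨t', rfl⟩)
  refine ⟨⟨X.kummerMapPInfty p hdiv t', hmem⟩, Subtype.ext ?_⟩
  rw [AddSubmonoidClass.coe_nsmul, ← map_nsmul, ht]

/-- **Every class of `Ш(E/F)[p^∞]` lifts to `Sel_{p^∞}(E/F)`** (`Sel_{p^∞}(E/F) ↠ Ш(E/F)[p^∞]`, the
tree's `map_primaryH1ToH1_selmerGroupPInfty`). Greenberg (1999), §2, p. 63. [folklore] -/
theorem exists_selmerGroupPInfty_primaryH1ToH1_eq {F : Type u} [Field F] [NumberField F]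
    (X : WeierstrassCurve F) [X.IsElliptic] (p : ℕ) [Fact p.Prime]
    {y : X.sha} (hy : y ∈ AddCommGroup.primaryComponent X.sha p) :
    ∃ s : selmerGroupPInfty X p, X.primaryH1ToH1 p (s : galH1Primary X p) = (y : X.galH1) := by
  have hmap := X.map_primaryH1ToH1_selmerGroupPInfty p X.zsmul_geomPoints_surjective_holds
  have hy' : (y : X.galH1) ∈ (AddCommGroup.primaryComponent X.sha p).map X.sha.subtype :=
    ⟨y, hy, rfl⟩
  rw [← hmap] at hy'
  obtain ⟨s, hs, hsy⟩ := hy'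
  exact ⟨⟨s, hs⟩, hsy⟩

/-- Conversely the image of a `p^∞`-Selmer class in `H¹(F, E)` lies in `Ш(E/F)[p^∞]`.
Greenberg (1999), §2, p. 63. [folklore] -/
theorem exists_primaryComponent_eq_primaryH1ToH1 {F : Type u} [Field F] [NumberField F]
    (X : WeierstrassCurve F) [X.IsElliptic] (p : ℕ) [Fact p.Prime] (s : selmerGroupPInfty X p) :
    ∃ y : X.sha, y ∈ AddCommGroup.primaryComponent X.sha p ∧
      (y : X.galH1) = X.primaryH1ToH1 p (s : galH1Primary X p) := by
  have hmap := X.map_primaryH1ToH1_selmerGroupPInfty p X.zsmul_geomPoints_surjective_holds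
  have hs : X.primaryH1ToH1 p (s : galH1Primary X p) ∈
      (selmerGroupPInfty X p).map (X.primaryH1ToH1 p) := ⟨s, s.2, rfl⟩
  rw [hmap] at hs
  obtain ⟨y, hy, hys⟩ := hs
  exact ⟨y, hy, by rw [← hys]; rfl⟩

/-- **A finite `p`-primary abelian group on which multiplication by `p` is onto is trivial**
(an onto self-map of a finite set is one-to-one, and `p^n` kills each element). [folklore] -/
theorem eq_bot_of_finite_of_nsmul_surjOn {A : Type*} [AddCommGroup A] {p : ℕ}
    (H : AddSubgroup A) [Finite H] (hprim : ∀ y ∈ H, ∃ n : ℕ, p ^ n • y = 0)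
    (hdiv : ∀ y ∈ H, ∃ y' ∈ H, p • y' = y) : H = ⊥ := by
  have hsurj : Function.Surjective (fun y : H ↦ p • y) := fun y ↦ by
    obtain ⟨y', hy', hyy'⟩ := hdiv y y.2
    exact ⟨⟨y', hy'⟩, Subtype.ext (by rw [AddSubmonoidClass.coe_nsmul, hyy'])⟩
  have hinj : Function.Injective (fun y : H ↦ p • y) :=
    Finite.injective_iff_surjective.mpr hsurj
  refine (AddSubgroup.eq_bot_iff_forall _).mpr fun y hy ↦ ?_
  obtain ⟨n, hn⟩ := hprim y hy
  have hinjn : Function.Injective (fun y : H ↦ p • y)^[n] := hinj.iterate n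
  rw [smul_iterate] at hinjn
  have h0 : (fun y : H ↦ p ^ n • y) ⟨y, hy⟩ = (fun y : H ↦ p ^ n • y) 0 := by
    simp only [smul_zero]
    exact Subtype.ext (by rw [AddSubmonoidClass.coe_nsmul, hn, ZeroMemClass.coe_zero])
  exact congrArg Subtype.val (hinjn h0)

variable (W : WeierstrassCurve ℚ) [W.IsElliptic] (K : Type) [Field K] [NumberField K]
  (h2 : Module.finrank ℚ K = 2)

include h2 in
/-- **`Ш(E/K)[p^∞]` is finite for every prime `p` once `Ш(E/ℚ)` and `Ш(E^{(d_K)}/ℚ)` are finite**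
(`K` a quadratic field). By the corank identities of the tree — Greenberg's
`corank Sel_{p^∞} = rank + corank Ш[p^∞]` over `ℚ`, over `ℚ` for the twist and over `K`
(`selmerCorank_eq_mordellWeilRank_add_holds`), T. Dokchitser's
`corank Sel_{p^∞}(E/K) = corank Sel_{p^∞}(E/ℚ) + corank Sel_{p^∞}(E^{(d_K)}/ℚ)`
(`selmerCorank_baseChange_quadratic_holds`, Dokchitser 2013, §4, after Dokchitser–Dokchitser
2010, Lemma 4.14) and `rank E(K) = rank E(ℚ) + rank E^{(d_K)}(ℚ)` (Silverman, *AEC*,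
Exercise 10.16, `mordellWeilRank_baseChange_quadratic_holds`) — `corank Ш(E/K)[p^∞] = 0`, and a
`p`-primary group of corank `0` with finite `p`-torsion is finite
(`finite_primaryComponent_sha_iff_shaCorank_eq_zero`).
[cite: Dokchitser2013ParityNotes, §4, proof of the Theorem "[Squarity, NekIV, Kurast]", first display]
[cite: Greenberg1999LNM, §1 pp. 54–57] -/
theorem finite_primaryComponent_sha_baseChange_of_shaFinite (hW : W.ShaFinite)
    (hWd : (W.quadraticTwist (NumberField.discr K : ℚ)).ShaFinite) (p : ℕ) [Fact p.Prime] :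
    Finite (AddCommGroup.primaryComponent (W.baseChange K).sha p) := by
  have hd : (NumberField.discr K : ℚ) ≠ 0 := by exact_mod_cast NumberField.discr_ne_zero K
  haveI := W.isElliptic_quadraticTwist hd
  haveI : (W.baseChange K).IsElliptic := by rw [baseChange]; infer_instance
  rw [finite_primaryComponent_sha_iff_shaCorank_eq_zero]
  have hS := selmerCorank_baseChange_quadratic_holds W K h2 p
  have hK := (W.baseChange K).selmerCorank_eq_mordellWeilRank_add_holds p
  have hQ := W.selmerCorank_eq_mordellWeilRank_add_holds p
  have hT := (W.quadraticTwist (NumberField.discr K : ℚ)).selmerCorank_eq_mordellWeilRank_add_holds p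
  have hr := mordellWeilRank_baseChange_quadratic_holds W K h2
  have hW0 : W.shaCorank p = 0 := by
    haveI : Finite W.sha := hW
    exact W.shaCorank_eq_zero_of_finite p
  have hWd0 : (W.quadraticTwist (NumberField.discr K : ℚ)).shaCorank p = 0 := by
    haveI : Finite (W.quadraticTwist (NumberField.discr K : ℚ)).sha := hWd
    exact (W.quadraticTwist (NumberField.discr K : ℚ)).shaCorank_eq_zero_of_finite p
  omega

variable {θ : K} {c : ℚ} (hθ : θ ∉ Set.range (algebraMap ℚ K)) (hc : θ ^ 2 = algebraMap ℚ K c)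

include h2 hθ hc in
/-- **At an odd prime `p` with `Ш(E/ℚ)[p^∞] = 0 = Ш(E^{(c)}/ℚ)[p^∞]`, a finite `Ш(E/K)[p^∞]`
vanishes** (`K = ℚ(θ)`, `θ² = c`). The comparison map
`Sel_{p^∞}(E/ℚ) × Sel_{p^∞}(E^{(c)}/ℚ) → Sel_{p^∞}(E/K)`, `(η, η') ↦ res η + ψ_*(res η')`, is an
isomorphism for odd `p` (`comparisonMap_bijective_of_odd`: Dokchitser–Dokchitser 2010, proof of
Lemma 4.14, kernel and cokernel killed by `8`); both factors are `p`-divisible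
(`exists_nsmul_eq_of_primaryComponent_sha_eq_bot`), hence so are `Sel_{p^∞}(E/K)` and its image
`Ш(E/K)[p^∞]` (`Sel_{p^∞}(E/K) ↠ Ш(E/K)[p^∞]`, Greenberg 1999, §2); a finite `p`-primary group on
which `p` is onto is trivial. [cite: DokchitserDokchitserAnnals2010, Lemma 4.14 (proof)]
[cite: Greenberg1999LNM, §2 pp. 62–63] -/
theorem primaryComponent_sha_baseChange_eq_bot_of_odd (p : ℕ) [Fact p.Prime] (hp : p ≠ 2)
    [(W.quadraticTwist c).IsElliptic]
    (hW : AddCommGroup.primaryComponent W.sha p = ⊥)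
    (hWc : AddCommGroup.primaryComponent (W.quadraticTwist c).sha p = ⊥)
    (hfin : Finite (AddCommGroup.primaryComponent (W.baseChange K).sha p)) :
    AddCommGroup.primaryComponent (W.baseChange K).sha p = ⊥ := by
  haveI : (W.baseChange K).IsElliptic := by rw [baseChange]; infer_instance
  have hodd : Odd p := (Fact.out : p.Prime).odd_of_ne_two hp
  -- `Sel_{p^∞}(E/K)` is `p`-divisible
  have hdivK : ∀ σ : selmerGroupPInfty (W.baseChange K) p,
      ∃ σ' : selmerGroupPInfty (W.baseChange K) p, p • σ' = σ := by
    intro σ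
    obtain ⟨x, rfl⟩ := (comparisonMap_bijective_of_odd W K h2 hθ hc p hodd).2 σ
    obtain ⟨s₁, hs₁⟩ := exists_nsmul_eq_of_primaryComponent_sha_eq_bot W p hW x.1
    obtain ⟨s₂, hs₂⟩ := exists_nsmul_eq_of_primaryComponent_sha_eq_bot (W.quadraticTwist c) p hWc x.2
    refine ⟨comparisonMap W K hθ hc p (s₁, s₂), ?_⟩
    rw [← map_nsmul]
    congr 1
    exact Prod.ext (by rw [Prod.smul_fst, hs₁]) (by rw [Prod.smul_snd, hs₂])
  -- hence so is its image `Ш(E/K)[p^∞]`, which is finite and `p`-primary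
  haveI := hfin
  refine eq_bot_of_finite_of_nsmul_surjOn (p := p) _ (fun y hy ↦ ?_) (fun y hy ↦ ?_)
  · exact (AddCommGroup.mem_primaryComponent).mp hy
  · obtain ⟨σ, hσ⟩ := exists_selmerGroupPInfty_primaryH1ToH1_eq (W.baseChange K) p hy
    obtain ⟨σ', rfl⟩ := hdivK σ
    obtain ⟨y', hy', hy'σ⟩ := exists_primaryComponent_eq_primaryH1ToH1 (W.baseChange K) p σ'
    refine ⟨y', hy', Subtype.ext ?_⟩
    rw [AddSubmonoidClass.coe_nsmul, hy'σ, ← map_nsmul, ← AddSubmonoidClass.coe_nsmul, hσ]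

/-- In a finite abelian group the `p`-primary component vanishes for every prime `p` exceeding
its order (Lagrange). [folklore] -/
theorem primaryComponent_eq_bot_of_card_lt {A : Type*} [AddCommGroup A] [Finite A] (p : ℕ)
    [hp : Fact p.Prime] (h : Nat.card A < p) : AddCommGroup.primaryComponent A p = ⊥ := by
  refine (AddSubgroup.eq_bot_iff_forall _).mpr fun y hy ↦ ?_
  obtain ⟨n, hn'⟩ := (AddCommGroup.mem_primaryComponent_iff_addOrderOf (p := p)).mp hy
  rcases n with _ | n
  · rw [pow_zero] at hn'
    exact AddMonoid.addOrderOf_eq_one_iff.mp hn'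
  · exfalso
    have hdvd : addOrderOf y ∣ Nat.card A := addOrderOf_dvd_natCard y
    rw [hn'] at hdvd
    have hle : p ^ (n + 1) ≤ Nat.card A := Nat.le_of_dvd Nat.card_pos hdvd
    have hp' : p ≤ p ^ (n + 1) := Nat.le_self_pow (Nat.succ_ne_zero n) p
    omega

include h2 in
/-- **`Ш(E/K)` is finite as soon as `Ш(E/ℚ)` and `Ш(E^{(d_K)}/ℚ)` are** (`E/ℚ` elliptic, `K` a
quadratic field of discriminant `d_K`). `Ш(E/K)` is torsion; every `Ш(E/K)[p^∞]` is finite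
(`finite_primaryComponent_sha_baseChange_of_shaFinite`), and for the odd primes `p` beyond
`#Ш(E/ℚ)` and `#Ш(E^{(c)}/ℚ)` (`K = ℚ(θ)`, `θ² = c`, `E^{(c)} ≅ E^{(d_K)}` over `ℚ` as `d_K = c q²`)
`Ш(E/K)[p^∞] = 0` (`primaryComponent_sha_baseChange_eq_bot_of_odd`); conclude by
`WeierstrassCurve.shaFinite_of_primary`. This is the converse of the descent
`Ш(E/K)` finite `⇒ Ш(E/ℚ), Ш(E^{(d_K)}/ℚ)` finite of `ShaRestriction` / `BSDQuadraticDescent`; both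
directions are the finiteness content of Milne's `Ш(Res_{K/ℚ} E_K) ≅ Ш(E_K/K)` with
`Res_{K/ℚ} E_K ∼ E × E^{(d_K)}` (Milne, Invent. Math. 17 (1972), §1, Thm. 1), obtained here through
the Selmer comparison of Dokchitser–Dokchitser 2010, Lemma 4.14.
[cite: DokchitserDokchitserAnnals2010, Lemma 4.14 (proof)] [cite: Milne1972ArithmeticAV, §1 Thm. 1] -/
theorem shaFinite_baseChange_of_shaFinite (hW : W.ShaFinite)
    (hWd : (W.quadraticTwist (NumberField.discr K : ℚ)).ShaFinite) : (W.baseChange K).ShaFinite := by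
  haveI : (W.baseChange K).IsElliptic := by rw [baseChange]; infer_instance
  obtain ⟨θ, c, hθ, hc⟩ := Quadratic.exists_sq_eq_algebraMap (F := ℚ) (K := K) h2
  obtain ⟨q, hq, hd⟩ := NumberField.exists_discr_eq_mul_sq h2 hθ hc
  obtain ⟨C, hC⟩ := W.exists_variableChange_quadraticTwist_mul_sq c q hq
  rw [← hd] at hC
  have hc0 : c ≠ 0 := by
    rintro rfl
    apply Quadratic.ne_zero_of_not_mem_range hθ
    have : θ ^ 2 = 0 := by rw [hc, map_zero]
    exact pow_eq_zero_iff (n := 2) (by norm_num) |>.mp this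
  haveI : (W.quadraticTwist c).IsElliptic := W.isElliptic_quadraticTwist hc0
  -- `Ш(E^{(c)}/ℚ)` is finite, `E^{(c)} ≅ E^{(d_K)}` over `ℚ`
  have hWc : (W.quadraticTwist c).ShaFinite := by
    have hWd' : (C • W.quadraticTwist c).ShaFinite := by rw [hC]; exact hWd
    exact (shaFinite_variableChange_iff_holds (W.quadraticTwist c) C).mp hWd'
  haveI : Finite W.sha := hW
  haveI : Finite (W.quadraticTwist c).sha := hWc
  refine (W.baseChange K).shaFinite_of_primary (fun p hp ↦ ?_) ⟨?_, ?_⟩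
  · haveI : Fact p.Prime := ⟨hp⟩
    haveI := finite_primaryComponent_sha_baseChange_of_shaFinite W K h2 hW hWd p
    have hset : {x : (W.baseChange K).sha | ∃ j : ℕ, p ^ j • x = 0} =
        (AddCommGroup.primaryComponent (W.baseChange K).sha p : Set (W.baseChange K).sha) := by
      ext x
      simp only [Set.mem_setOf_eq, SetLike.mem_coe, AddCommGroup.mem_primaryComponent]
    rw [hset]
    exact Set.toFinite _
  · exact Finset.range (max (Nat.card W.sha) (Nat.card (W.quadraticTwist c).sha) + 3)
  · intro p hp hpS x hx
    haveI : Fact p.Prime := ⟨hp⟩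
    have hp' : max (Nat.card W.sha) (Nat.card (W.quadraticTwist c).sha) + 3 ≤ p := by
      simpa [Finset.mem_range] using hpS
    have hp2 : p ≠ 2 := by omega
    have hbot := primaryComponent_sha_baseChange_eq_bot_of_odd W K h2 hθ hc p hp2
      (primaryComponent_eq_bot_of_card_lt p (by omega))
      (primaryComponent_eq_bot_of_card_lt p (by omega))
      (finite_primaryComponent_sha_baseChange_of_shaFinite W K h2 hW hWd p)
    have hxmem : x ∈ AddCommGroup.primaryComponent (W.baseChange K).sha p :=
      (AddCommGroup.mem_primaryComponent).mpr ⟨1, by rw [pow_one]; exact hx⟩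
    rw [hbot, AddSubgroup.mem_bot] at hxmem
    exact hxmem

end ShaDescent

/-! ## §B. Gross–Zagier–Kolyvagin over `ℚ` for non-CM curves from Theorem A in the MAIN case -/

section MainCase

open ModularForms WeierstrassCurve.QuadraticDescent

/-- **The Heegner field of Darmon's proof with `|d_K| > 4`** (Darmon 2004, §3.9, proof of
Thm. 3.22, items (1)–(2)). As `exists_heegnerField_analyticRankEK_eq_one_of` (`LeadingTermProofs`),
but keeping the bound printed in both non-vanishing theorems ("infinitely many `D`", rendered in
`waldspurger_exists_heegnerField_twist_ne_zero` / `murtyMurty_exists_heegnerField_twist_simpleZero`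
as "for every bound `B` some `K` with `|d_K| > B`"): for an elliptic `W/ℚ` with
`ord_{s=1} L(W, s) ≤ 1` there is an imaginary quadratic `K` with `|d_K| > 4` — so
`d_K ∉ {-3, -4}` and `𝒪_K^× = {±1}` — satisfying the Heegner hypothesis for `N_W` with
`ord_{s=1} L(W/K, s) = 1`. [cite: Darmon2004, §3.9, proof of Thm. 3.22, (1)–(2)] -/
theorem exists_heegnerField_four_lt_analyticRankEK_eq_one_of
    (hpar : ∀ W : WeierstrassCurve ℚ, W.even_analyticRank_iff)
    (hWa : waldspurger_exists_heegnerField_twist_ne_zero)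
    (hMM : murtyMurty_exists_heegnerField_twist_simpleZero) (hE : hasEntireLFunction_rat)
    (W : WeierstrassCurve ℚ) [W.IsElliptic] (h : W.analyticRank ≤ 1) :
    ∃ (K : Type) (_ : Field K) (_ : NumberField K), IsImaginaryQuadratic K ∧
      4 < (NumberField.discr K).natAbs ∧
      SatisfiesHeegnerHypothesis (W.conductorNorm ℤ) K ∧ analyticRankEK W K = 1 := by
  rcases Nat.le_one_iff_eq_zero_or_eq_one.mp h with h0 | h1
  · -- `r = 0`: `L(E,1) ≠ 0`; Murty–Murty gives a twist with a simple zero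
    have hL : W.entireLFunction 1 ≠ 0 := (W.analyticRank_eq_zero_iff_holds (hE W)).mp h0
    obtain ⟨K, _, _, hKq, hB, hH, h0', h1'⟩ := hMM W hL 4
    refine ⟨K, _, _, hKq, hB, hH, ?_⟩
    have hd : (NumberField.discr K : ℚ) ≠ 0 := by exact_mod_cast NumberField.discr_ne_zero K
    haveI := W.isElliptic_quadraticTwist hd
    set W' := W.quadraticTwist (NumberField.discr K : ℚ) with hW'
    have hg : AnalyticAt ℂ W'.entireLFunction 1 :=
      (W'.differentiable_entireLFunction (hE W')).analyticAt 1
    have htw : W'.analyticRank = 1 := by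
      have h1 := hg.analyticOrderAt_eq_one_of_zero_deriv_ne_zero h0' h1'
      simp only [WeierstrassCurve.analyticRank, analyticOrderNatAt, h1]
      rfl
    rw [analyticRankEK_eq_add_of hE, h0, htw]
  · -- `r = 1`: `w(E) = -1` by parity; Waldspurger gives a twist with `L(E^{(d_K)},1) ≠ 0`
    have hw : W.rootNumber = -1 := by
      rcases W.rootNumber_eq_one_or with hw | hw
      · exact absurd ((hpar W).mpr hw) (by rw [h1]; exact Nat.not_even_one)
      · exact hw
    obtain ⟨K, _, _, hKq, hB, hH, hL'⟩ := hWa W hw 4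
    refine ⟨K, _, _, hKq, hB, hH, ?_⟩
    have hd : (NumberField.discr K : ℚ) ≠ 0 := by exact_mod_cast NumberField.discr_ne_zero K
    haveI := W.isElliptic_quadraticTwist hd
    set W' := W.quadraticTwist (NumberField.discr K : ℚ) with hW'
    have hg : AnalyticAt ℂ W'.entireLFunction 1 :=
      (W'.differentiable_entireLFunction (hE W')).analyticAt 1
    have htw : W'.analyticRank = 0 := by
      have h0 := hg.analyticOrderAt_eq_zero.mpr hL'
      simp only [WeierstrassCurve.analyticRank, analyticOrderNatAt, h0]
      rfl
    rw [analyticRankEK_eq_add_of hE, h1, htw]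

/-- `|d_K| > 4` excludes the two fields with extra units: `d_K ∉ {-3, -4}`. [folklore] -/
theorem discr_ne_of_four_lt {K : Type*} [Field K] [NumberField K]
    (h : 4 < (NumberField.discr K).natAbs) :
    NumberField.discr K ≠ -3 ∧ NumberField.discr K ≠ -4 := by
  constructor <;> intro hd <;> rw [hd] at h <;> simp at h

/-- The non-trivial automorphism of a quadratic field `K = ℚ(θ)`, `θ² = c`: the reflection
`Quadratic.conj` is not the identity. [folklore] -/
theorem Quadratic.conj_ne_id {K : Type*} [Field K] [NumberField K] (h2 : Module.finrank ℚ K = 2)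
    {θ : K} {c : ℚ} (hθ : θ ∉ Set.range (algebraMap ℚ K)) (hc : θ ^ 2 = algebraMap ℚ K c) :
    Quadratic.conj h2 hθ hc ≠ AlgHom.id ℚ K := by
  intro hid
  have h1 : Quadratic.conj h2 hθ hc θ = -θ := Quadratic.conj_gen h2 hθ hc
  rw [hid, AlgHom.id_apply] at h1
  have h2θ : (2 : K) * θ = 0 := by linear_combination h1
  exact Quadratic.ne_zero_of_not_mem_range hθ ((mul_eq_zero.mp h2θ).resolve_left two_ne_zero)

/-- **The case `ord_{s=1} L(E, s) = 1` of Darmon's proof of Thm. 3.22, over a class `C`, with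
the Waldspurger configuration exposed** (Darmon 2004, §3.9: `w(E) = -1` by parity, a Heegner
field `K` with `L(E^{(d_K)}, 1) ≠ 0` by Waldspurger — here with `|d_K| > 4` —, `L'(E/K, 1) ≠ 0`,
`P_K` non-torsion by Gross–Zagier, Kolyvagin over `K`, Prop. 3.11 and the descent). Kolyvagin's
theorem is used only at `(N_E, E, K)` with `E ∈ C` globally minimal, `d_K ∉ {-3, -4}` and
`L(E^{(d_K)}, 1) ≠ 0` (`hKo1`). Conclusion: `rank E(ℚ) = 1` and `Ш(E/ℚ)` is finite.
[cite: Darmon2004, Thm. 3.22 and §3.9] -/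
theorem mordellWeilRank_eq_one_of_isGloballyMinimal_of_thmA_on_waldspurger
    (C : WeierstrassCurve ℚ → Prop) (hpar : ∀ W : WeierstrassCurve ℚ, W.even_analyticRank_iff)
    (hWa : waldspurger_exists_heegnerField_twist_ne_zero) (hE : hasEntireLFunction_rat)
    (hGZ : ∀ (N : ℕ) [NeZero N] (W : WeierstrassCurve ℚ) (K : Type) [Field K] [NumberField K],
      gross_zagier N W K)
    (hHP : ∀ (W : WeierstrassCurve ℚ) (K : Type) [Field K] [NumberField K],
      exists_isHeegnerPoint W K)
    (hKo1 : ∀ (N : ℕ) [NeZero N] (W : WeierstrassCurve ℚ) (K : Type) [Field K] [NumberField K],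
      C W → NumberField.discr K ≠ -3 ∧ NumberField.discr K ≠ -4 →
        (W.quadraticTwist (NumberField.discr K : ℚ)).entireLFunction 1 ≠ 0 → kolyvagin N W K)
    (W : WeierstrassCurve ℚ) [W.IsElliptic] [W.IsGloballyMinimal] (hW : C W)
    (h1 : W.analyticRank = 1) :
    W.mordellWeilRank = 1 ∧ Finite W.sha := by
  haveI : NeZero (W.conductorNorm ℤ) := ⟨(W.conductorNorm_pos_holds).ne'⟩
  -- `w(E) = -1` by parity; Waldspurger's Heegner field with `|d_K| > 4` and `L(E^{(d_K)}, 1) ≠ 0`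
  have hw : W.rootNumber = -1 := by
    rcases W.rootNumber_eq_one_or with hw | hw
    · exact absurd ((hpar W).mpr hw) (by rw [h1]; exact Nat.not_even_one)
    · exact hw
  obtain ⟨K, _, _, hKq, hB, hH, hL'⟩ := hWa W hw 4
  have hd : (NumberField.discr K : ℚ) ≠ 0 := by exact_mod_cast NumberField.discr_ne_zero K
  haveI := W.isElliptic_quadraticTwist hd
  have htw : (W.quadraticTwist (NumberField.discr K : ℚ)).analyticRank = 0 := by
    have hg : AnalyticAt ℂ (W.quadraticTwist (NumberField.discr K : ℚ)).entireLFunction 1 :=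
      ((W.quadraticTwist _).differentiable_entireLFunction (hE _)).analyticAt 1
    have h0 := hg.analyticOrderAt_eq_zero.mpr hL'
    simp only [WeierstrassCurve.analyticRank, analyticOrderNatAt, h0]
    rfl
  have hr : analyticRankEK W K = 1 := by rw [analyticRankEK_eq_add_of hE, h1, htw]
  -- `L'(E/K, 1) ≠ 0`, the Heegner point is non-torsion, Kolyvagin at this instance
  have hL : LDerivEK W K ≠ 0 := LDerivEK_ne_zero_of_analyticRankEK_eq_one W K hr
  obtain ⟨P, hP⟩ := hHP W K hKq hH
  have hPnt : ¬ IsOfFinAddOrder P :=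
    not_isOfFinAddOrder_of_isHeegnerPoint_of_LDerivEK_ne_zero (hGZ _ W K hKq hH) hP hL
  obtain ⟨hrkK, hshaK⟩ := hKo1 _ W K hW (discr_ne_of_four_lt hB) hL' hKq hH hP hPnt
  refine ⟨?_, shaFinite_of_shaFinite_baseChange_holds W K hshaK⟩
  -- Prop. 3.11 with `w(E) = -1`: `σ P_K = P_K` up to torsion, so `rank E(ℚ) ≥ 1`; and `≤ 1`
  obtain ⟨θ, c, hθ, hc⟩ := Quadratic.exists_sq_eq_algebraMap (F := ℚ) (K := K) hKq.1
  have hσ := Quadratic.conj_ne_id hKq.1 hθ hc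
  have hT := heegnerPoint_conj_add_rootNumber_smul_holds W K hKq hH hP _ hσ
  rw [hw, neg_one_zsmul, ← sub_eq_add_neg] at hT
  have hge := one_le_mordellWeilRank_of_conjMap_sub_isOfFinAddOrder hKq.1 W
    W.module_finite_point_holds hσ hPnt hT
  haveI : (W.baseChange K).IsElliptic := by rw [baseChange]; infer_instance
  have hsum := W.mordellWeilRank_add_eq_of_baseChange K hKq.1 one_ne_zero hrkK
  omega

/-- **bsd.S17 for a globally minimal curve in a class `C`, from Kolyvagin's Theorem A for the
curves of `C` over fields with `d_K ∉ {-3, -4}` only** (Darmon 2004, §3.9, proof of Thm. 3.22,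
verbatim; cf. `rank_eq_analyticRank_of_isGloballyMinimal_of_heegnerPoint` of
`LeadingTermHeegnerProofs`, whose Kolyvagin input quantifies over *all* `(E, K)`). Inputs: parity
of `ord_{s=1} L(E, s)` (`hpar`), Waldspurger / Murty–Murty (`hWa`, `hMM`), modularity as entire
continuation (`hE`), the Gross–Zagier formula (`hGZ`), `K`-rationality of Heegner points (`hHP`),
and Kolyvagin's theorem `kolyvagin N E K` **only for `E ∈ C` and `d_K ∉ {-3, -4}`** (`hKo`;
`C = ` non-CM is exactly the case treated in Gross 1991: §1 "for simplicity, we assume that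
`D ≠ 3, 4`", §2 "we assume that the curve `E` does not have complex multiplication"). The auxiliary
Heegner field is taken with `|d_K| > 4` (`exists_heegnerField_four_lt_analyticRankEK_eq_one_of`),
so only such instances of Theorem A are invoked; Prop. 3.11 is the tree's theorem
`heegnerPoint_conj_add_rootNumber_smul_holds`. Conclusion for `E ∈ C`:
`rank E(ℚ) = ord_{s=1} L(E, s)` and `Ш(E/ℚ)` is finite.
[cite: Darmon2004, Thm. 3.22 and §3.9] [cite: GrossLMS1991, §1 Thm. 1.3 and §2] -/
theorem rank_eq_analyticRank_of_isGloballyMinimal_of_thmA_on (C : WeierstrassCurve ℚ → Prop)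
    (hpar : ∀ W : WeierstrassCurve ℚ, W.even_analyticRank_iff)
    (hWa : waldspurger_exists_heegnerField_twist_ne_zero)
    (hMM : murtyMurty_exists_heegnerField_twist_simpleZero) (hE : hasEntireLFunction_rat)
    (hGZ : ∀ (N : ℕ) [NeZero N] (W : WeierstrassCurve ℚ) (K : Type) [Field K] [NumberField K],
      gross_zagier N W K)
    (hHP : ∀ (W : WeierstrassCurve ℚ) (K : Type) [Field K] [NumberField K],
      exists_isHeegnerPoint W K)
    (hKo : ∀ (N : ℕ) [NeZero N] (W : WeierstrassCurve ℚ) (K : Type) [Field K] [NumberField K],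
      C W → NumberField.discr K ≠ -3 ∧ NumberField.discr K ≠ -4 → kolyvagin N W K)
    (W : WeierstrassCurve ℚ) [W.IsElliptic] [W.IsGloballyMinimal] (hCM : C W)
    (h : W.analyticRank ≤ 1) :
    W.mordellWeilRank = W.analyticRank ∧ Finite W.sha := by
  rcases Nat.le_one_iff_eq_zero_or_eq_one.mp h with h0 | h1
  · -- `ord L(E) = 0`: Murty–Murty's Heegner field with `|d_K| > 4`; `sign(E, ℚ) = +1`,
    -- `σ P_K = -P_K` up to torsion, so `rank E(ℚ) = 0`
    haveI : NeZero (W.conductorNorm ℤ) := ⟨(W.conductorNorm_pos_holds).ne'⟩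
    obtain ⟨K, _, _, hKq, hB, hH, hr⟩ :=
      exists_heegnerField_four_lt_analyticRankEK_eq_one_of hpar hWa hMM hE W h
    have hL : LDerivEK W K ≠ 0 := LDerivEK_ne_zero_of_analyticRankEK_eq_one W K hr
    obtain ⟨P, hP⟩ := hHP W K hKq hH
    have hPnt : ¬ IsOfFinAddOrder P :=
      not_isOfFinAddOrder_of_isHeegnerPoint_of_LDerivEK_ne_zero (hGZ _ W K hKq hH) hP hL
    obtain ⟨hrkK, hshaK⟩ := hKo _ W K hCM (discr_ne_of_four_lt hB) hKq hH hP hPnt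
    refine ⟨?_, shaFinite_of_shaFinite_baseChange_holds W K hshaK⟩
    obtain ⟨θ, c, hθ, hc⟩ := Quadratic.exists_sq_eq_algebraMap (F := ℚ) (K := K) hKq.1
    have hσ := Quadratic.conj_ne_id hKq.1 hθ hc
    have hT := heegnerPoint_conj_add_rootNumber_smul_holds W K hKq hH hP _ hσ
    haveI : (W.baseChange K).IsElliptic := by rw [baseChange]; infer_instance
    have hw : W.rootNumber = 1 := (hpar W).mp (by rw [h0]; exact Even.zero)
    rw [hw, one_zsmul] at hT
    rw [h0]
    exact mordellWeilRank_eq_zero_of_conjMap_add_isOfFinAddOrder W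
      (W.baseChange K).module_finite_point_holds hrkK _ hPnt hT
  · -- `ord L(E) = 1`: the Waldspurger branch
    rw [h1]
    exact mordellWeilRank_eq_one_of_isGloballyMinimal_of_thmA_on_waldspurger C hpar hWa hE hGZ hHP
      (fun N _ W K _ _ hW hD _ ↦ hKo N W K hW hD) W hCM h1

/-- **bsd.S17 for every curve of a class `C` stable under changes of variables, from Theorem A for
`C` over fields with `d_K ∉ {-3, -4}`**: reduction to a globally minimal model
(`hasGlobalMinimalModel_rat_holds`; rank, analytic rank and finiteness of `Ш` are invariant under
admissible changes of variables — `mordellWeilRank_variableChange_holds`,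
`analyticRank_variableChange_holds`, `shaFinite_variableChange_iff_holds`).
[cite: Darmon2004, Thm. 3.22 and §3.9] -/
theorem rank_eq_analyticRank_of_thmA_on (C : WeierstrassCurve ℚ → Prop)
    (hCvar : ∀ (W : WeierstrassCurve ℚ) [W.IsElliptic] (C' : VariableChange ℚ), C W → C (C' • W))
    (hpar : ∀ W : WeierstrassCurve ℚ, W.even_analyticRank_iff)
    (hWa : waldspurger_exists_heegnerField_twist_ne_zero)
    (hMM : murtyMurty_exists_heegnerField_twist_simpleZero) (hE : hasEntireLFunction_rat)
    (hGZ : ∀ (N : ℕ) [NeZero N] (W : WeierstrassCurve ℚ) (K : Type) [Field K] [NumberField K],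
      gross_zagier N W K)
    (hHP : ∀ (W : WeierstrassCurve ℚ) (K : Type) [Field K] [NumberField K],
      exists_isHeegnerPoint W K)
    (hKo : ∀ (N : ℕ) [NeZero N] (W : WeierstrassCurve ℚ) (K : Type) [Field K] [NumberField K],
      C W → NumberField.discr K ≠ -3 ∧ NumberField.discr K ≠ -4 → kolyvagin N W K)
    (W : WeierstrassCurve ℚ) [W.IsElliptic] (hCM : C W) (h : W.analyticRank ≤ 1) :
    W.mordellWeilRank = W.analyticRank ∧ W.ShaFinite := by
  obtain ⟨C', hC'⟩ := hasGlobalMinimalModel_rat_holds W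
  haveI := hC'
  have hanC : (C' • W).analyticRank = W.analyticRank := analyticRank_variableChange_holds W C'
  have h' : (C' • W).analyticRank ≤ 1 := by rwa [hanC]
  obtain ⟨hr, hs⟩ := rank_eq_analyticRank_of_isGloballyMinimal_of_thmA_on C hpar hWa hMM hE hGZ
    hHP hKo (C' • W) (hCvar W C' hCM) h'
  have hrkC : (C' • W).mordellWeilRank = W.mordellWeilRank := mordellWeilRank_variableChange_holds W C'
  refine ⟨?_, ?_⟩
  · rwa [hrkC, hanC] at hr
  · exact (shaFinite_variableChange_iff_holds W C').mp hs

/-- **bsd.S17 for a globally minimal NON-CM curve, from Kolyvagin's Theorem A in the main case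
only** (`E` non-CM, `d_K ∉ {-3, -4}`: the case treated by Gross 1991, §§1–2):
`rank_eq_analyticRank_of_isGloballyMinimal_of_thmA_on` for the class of non-CM curves.
[cite: Darmon2004, Thm. 3.22 and §3.9] [cite: GrossLMS1991, §1 Thm. 1.3 and §2] -/
theorem rank_eq_analyticRank_of_isGloballyMinimal_of_not_hasCM_of_mainCase
    (hpar : ∀ W : WeierstrassCurve ℚ, W.even_analyticRank_iff)
    (hWa : waldspurger_exists_heegnerField_twist_ne_zero)
    (hMM : murtyMurty_exists_heegnerField_twist_simpleZero) (hE : hasEntireLFunction_rat)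
    (hGZ : ∀ (N : ℕ) [NeZero N] (W : WeierstrassCurve ℚ) (K : Type) [Field K] [NumberField K],
      gross_zagier N W K)
    (hHP : ∀ (W : WeierstrassCurve ℚ) (K : Type) [Field K] [NumberField K],
      exists_isHeegnerPoint W K)
    (hKo : ∀ (N : ℕ) [NeZero N] (W : WeierstrassCurve ℚ) (K : Type) [Field K] [NumberField K],
      ¬ W.HasCM → NumberField.discr K ≠ -3 ∧ NumberField.discr K ≠ -4 → kolyvagin N W K)
    (W : WeierstrassCurve ℚ) [W.IsElliptic] [W.IsGloballyMinimal] (hCM : ¬ W.HasCM)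
    (h : W.analyticRank ≤ 1) :
    W.mordellWeilRank = W.analyticRank ∧ Finite W.sha :=
  rank_eq_analyticRank_of_isGloballyMinimal_of_thmA_on (fun W ↦ ¬ W.HasCM) hpar hWa hMM hE hGZ hHP
    hKo W hCM h

/-- `HasCM` is invariant under admissible changes of variables (it depends only on `j`:
`hasCM_iff_of_j_eq`, Mathlib `variableChange_j`). [cite: SilvermanAEC2009, III.1.4(b)] -/
theorem not_hasCM_variableChange (W : WeierstrassCurve ℚ) [W.IsElliptic] (C' : VariableChange ℚ)
    (hCM : ¬ W.HasCM) : ¬ (C' • W).HasCM := by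
  rwa [hasCM_iff_of_j_eq (W.variableChange_j C')]

/-- **bsd.S17 for every NON-CM curve, from Theorem A in the main case** — the named fact
`rank_eq_analyticRank_of_analyticRank_le_one` restricted to curves without complex multiplication
(`rank_eq_analyticRank_of_thmA_on` for the class of non-CM curves, stable under changes of
variables by `not_hasCM_variableChange`). [cite: Darmon2004, Thm. 3.22 and §3.9] -/
theorem rank_eq_analyticRank_of_not_hasCM_of_mainCase
    (hpar : ∀ W : WeierstrassCurve ℚ, W.even_analyticRank_iff)
    (hWa : waldspurger_exists_heegnerField_twist_ne_zero)
    (hMM : murtyMurty_exists_heegnerField_twist_simpleZero) (hE : hasEntireLFunction_rat)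
    (hGZ : ∀ (N : ℕ) [NeZero N] (W : WeierstrassCurve ℚ) (K : Type) [Field K] [NumberField K],
      gross_zagier N W K)
    (hHP : ∀ (W : WeierstrassCurve ℚ) (K : Type) [Field K] [NumberField K],
      exists_isHeegnerPoint W K)
    (hKo : ∀ (N : ℕ) [NeZero N] (W : WeierstrassCurve ℚ) (K : Type) [Field K] [NumberField K],
      ¬ W.HasCM → NumberField.discr K ≠ -3 ∧ NumberField.discr K ≠ -4 → kolyvagin N W K)
    (W : WeierstrassCurve ℚ) [W.IsElliptic] (hCM : ¬ W.HasCM) (h : W.analyticRank ≤ 1) :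
    W.mordellWeilRank = W.analyticRank ∧ W.ShaFinite :=
  rank_eq_analyticRank_of_thmA_on (fun W ↦ ¬ W.HasCM) (fun W _ C' h ↦ not_hasCM_variableChange W C' h)
    hpar hWa hMM hE hGZ hHP hKo W hCM h

/-- **bsd.S17 for EVERY curve from Theorem A over fields with `d_K ∉ {-3, -4}` only**: Gross's
standing simplification "`D ≠ 3, 4`" (Gross 1991, §1) costs nothing in the deduction of the
theorem of Gross–Zagier–Kolyvagin over `ℚ` (`rank_eq_analyticRank_of_thmA_on` for the class of all
curves). [cite: Darmon2004, Thm. 3.22 and §3.9] [cite: GrossLMS1991, §1] -/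
theorem rank_eq_analyticRank_of_thmA_discr_ne
    (hpar : ∀ W : WeierstrassCurve ℚ, W.even_analyticRank_iff)
    (hWa : waldspurger_exists_heegnerField_twist_ne_zero)
    (hMM : murtyMurty_exists_heegnerField_twist_simpleZero) (hE : hasEntireLFunction_rat)
    (hGZ : ∀ (N : ℕ) [NeZero N] (W : WeierstrassCurve ℚ) (K : Type) [Field K] [NumberField K],
      gross_zagier N W K)
    (hHP : ∀ (W : WeierstrassCurve ℚ) (K : Type) [Field K] [NumberField K],
      exists_isHeegnerPoint W K)
    (hKo : ∀ (N : ℕ) [NeZero N] (W : WeierstrassCurve ℚ) (K : Type) [Field K] [NumberField K],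
      NumberField.discr K ≠ -3 ∧ NumberField.discr K ≠ -4 → kolyvagin N W K)
    (W : WeierstrassCurve ℚ) [W.IsElliptic] (h : W.analyticRank ≤ 1) :
    W.mordellWeilRank = W.analyticRank ∧ W.ShaFinite :=
  rank_eq_analyticRank_of_thmA_on (fun _ ↦ True) (fun _ _ _ _ ↦ trivial) hpar hWa hMM hE hGZ hHP
    (fun N _ W K _ _ _ hD ↦ hKo N W K hD) W trivial h

end MainCase

/-! ## §C. The leaf for `E` without CM (so `d_K ∈ {-3, -4}`): the twist route -/

section Leaf

open ModularForms

variable {N : ℕ} [NeZero N] {W : WeierstrassCurve ℚ} {K : Type} [Field K] [NumberField K]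

/-- **`y_K` of infinite order forces `ord_{s=1} L(E, s) + ord_{s=1} L(E^{(d_K)}, s) ≤ 1`**
(Gross–Zagier 1986, Thm. I.6.3 and I.§7; Gross 1991, (1.1)). From the Gross–Zagier formula at
`(N, E, K)` (`hGZ`; every `d_K`, Cai–Shu–Tian 2014) and a Heegner point `P` of level `N` of
infinite order: `L'(E/K, 1) = (positive constant) · ĥ(P) ≠ 0`
(`GrossZagierFormula.lDerivEK_ne_zero_iff`, `maninConstant_ne_zero_holds`,
`canonicalHeight_eq_zero_iff_holds`), so the entire function `L(E/K, s) = L(E, s) L(E^{(d_K)}, s)`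
(modularity, `hE`) vanishes to order `≤ 1` at `s = 1`, and orders of vanishing add
(`analyticRankEK_eq_add_of`). [cite: GrossZagier1986, Thm. I.6.3 and I.§7] [cite: Gross1991, (1.1)] -/
theorem analyticRank_add_le_one_of_isHeegnerPoint_of_not_isOfFinAddOrder [W.IsElliptic]
    (hE : hasEntireLFunction_rat) (hGZ : gross_zagier N W K) (hK : IsImaginaryQuadratic K)
    (hH : SatisfiesHeegnerHypothesis N K) {P : (W.baseChange K).toAffine.Point}
    (hP : IsHeegnerPoint N W K P) (hnt : ¬ IsOfFinAddOrder P) :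
    W.analyticRank + (W.quadraticTwist (NumberField.discr K : ℚ)).analyticRank ≤ 1 := by
  haveI : (W.baseChange K).IsElliptic := by rw [baseChange]; infer_instance
  -- Gross–Zagier: `L'(E/K, 1) ≠ 0`
  obtain ⟨Dt, Hd, ι, hι⟩ := hP
  have hL : LDerivEK W K ≠ 0 :=
    ((hGZ hK hH).lDerivEK_ne_zero_iff Dt Dt.maninConstant_ne_zero_holds Hd ι P hι).mpr
      fun h0 ↦ hnt ((Affine.Point.canonicalHeight_eq_zero_iff_holds (W := W.baseChange K) P).mp h0)
  -- so `ord_{s=1} L(E/K, s) ≤ 1`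
  have hd : (NumberField.discr K : ℚ) ≠ 0 := by exact_mod_cast NumberField.discr_ne_zero K
  haveI := W.isElliptic_quadraticTwist hd
  set W' := W.quadraticTwist (NumberField.discr K : ℚ) with hW'
  have hf : AnalyticAt ℂ W.entireLFunction 1 := (W.differentiable_entireLFunction (hE W)).analyticAt 1
  have hg : AnalyticAt ℂ W'.entireLFunction 1 :=
    (W'.differentiable_entireLFunction (hE W')).analyticAt 1
  have hfg : AnalyticAt ℂ (fun s ↦ W.entireLFunction s * W'.entireLFunction s) 1 := hf.mul hg
  have hle : analyticRankEK W K ≤ 1 := by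
    change analyticOrderNatAt (fun s ↦ W.entireLFunction s * W'.entireLFunction s) 1 ≤ 1
    by_cases h0 : W.entireLFunction 1 * W'.entireLFunction 1 = 0
    · have h1 := hfg.analyticOrderAt_eq_one_of_zero_deriv_ne_zero h0 hL
      simp only [analyticOrderNatAt, h1]
      rfl
    · have h1 := hfg.analyticOrderAt_eq_zero.mpr h0
      simp only [analyticOrderNatAt, h1]
      exact zero_le_one
  rw [analyticRankEK_eq_add_of hE] at hle
  exact hle

/-- **Kolyvagin's Theorem A over any `K` for the curves of a class `C`, from Theorem A for `C`
over fields with `d_K ∉ {-3, -4}`** (the twist route). Let `C` be a class of curves over `ℚ`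
stable under changes of variables (`hCvar`) and quadratic twists (`hCtw`), `E ∈ C`, `K` imaginary
quadratic with the Heegner hypothesis for `N`, and `P = y_K ∈ E(K)` a Heegner point of level `N`
of infinite order. Then `rank E(K) = 1` and `Ш(E/K)` is finite:
* Gross–Zagier at `(N, E, K)` gives `ord L(E) + ord L(E^{(d_K)}) ≤ 1`
  (`analyticRank_add_le_one_of_isHeegnerPoint_of_not_isOfFinAddOrder`);
* `E, E^{(d_K)} ∈ C`, so by bsd.S17 FROM THEOREM A FOR `C` AND `d ∉ {-3, -4}`
  (`rank_eq_analyticRank_of_thmA_on`: the auxiliary Heegner fields have `|d| > 4`)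
  `rank E(ℚ) = ord L(E)`, `rank E^{(d_K)}(ℚ) = ord L(E^{(d_K)})` and `Ш(E/ℚ)`, `Ш(E^{(d_K)}/ℚ)`
  are finite;
* `rank E(K) = rank E(ℚ) + rank E^{(d_K)}(ℚ) ≤ 1` (Silverman, *AEC*, Exercise 10.16,
  `mordellWeilRank_baseChange_quadratic_holds`) and `rank E(K) ≥ 1` (`y_K`, Mordell–Weil);
* `Ш(E/K)` is finite by `shaFinite_baseChange_of_shaFinite` (§A).
No Euler system over `K` itself is used: the units `𝒪_K^× ⊋ {±1}` of `ℚ(i)`, `ℚ(√-3)`, which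
alter the norm relations of Gross 1991, §3, never enter. Inputs, all named facts of the tree
stating printed theorems: modularity (`hmod`, Breuil–Conrad–Diamond–Taylor 2001, Thm. A,
supplying the entire continuation and the functional equation with its sign through
`RootNumberModularityProofs` / `AnalyticRankModularityProofs` and Atkin–Lehner,
`HeegnerPointReflectionHolds`), Waldspurger 1985 (`hWa`), Murty–Murty 1991 (`hMM`), Gross–Zagier
(`hGZ`; GZ 1986 Thm. I.6.3, Cai–Shu–Tian 2014 Thm. 1.1 for even `d_K`), `K`-rationality of
Heegner points (`hHP`, Gross 1984), and Kolyvagin's Theorem A for `E' ∈ C`, `d_{K'} ∉ {-3, -4}`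
(`hKo`). [cite: McCallumLMS1991, §1 Theorem (Kolyvagin)] [cite: GrossLMS1991, §1 Thm. 1.3]
[cite: Darmon2004, Thm. 3.22 and §3.9] -/
theorem mordellWeilRank_eq_one_and_shaFinite_of_thmA_on (C : WeierstrassCurve ℚ → Prop)
    (hCvar : ∀ (W : WeierstrassCurve ℚ) [W.IsElliptic] (C' : VariableChange ℚ), C W → C (C' • W))
    (hCtw : ∀ (W : WeierstrassCurve ℚ) [W.IsElliptic] (d : ℚ), d ≠ 0 → C W → C (W.quadraticTwist d))
    (hmod : existsUnique_isNewformOf)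
    (hWa : waldspurger_exists_heegnerField_twist_ne_zero)
    (hMM : murtyMurty_exists_heegnerField_twist_simpleZero)
    (hGZ : ∀ (N : ℕ) [NeZero N] (W : WeierstrassCurve ℚ) (K : Type) [Field K] [NumberField K],
      gross_zagier N W K)
    (hHP : ∀ (W : WeierstrassCurve ℚ) (K : Type) [Field K] [NumberField K],
      exists_isHeegnerPoint W K)
    (hKo : ∀ (N : ℕ) [NeZero N] (W : WeierstrassCurve ℚ) (K : Type) [Field K] [NumberField K],
      C W → NumberField.discr K ≠ -3 ∧ NumberField.discr K ≠ -4 → kolyvagin N W K)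
    [W.IsElliptic] (hW : C W) (hK : IsImaginaryQuadratic K) (hH : SatisfiesHeegnerHypothesis N K)
    {P : (W.baseChange K).toAffine.Point} (hP : IsHeegnerPoint N W K P) (hnt : ¬ IsOfFinAddOrder P) :
    (W.baseChange K).mordellWeilRank = 1 ∧ (W.baseChange K).ShaFinite := by
  haveI : (W.baseChange K).IsElliptic := by rw [baseChange]; infer_instance
  have hE : hasEntireLFunction_rat := WeierstrassCurve.hasEntireLFunction_rat_of_modularity hmod
  have hpar : ∀ W : WeierstrassCurve ℚ, W.even_analyticRank_iff := fun W ↦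
    W.even_analyticRank_iff_of hE (W.hasFunctionalEquationSign_rootNumber_of_modularity hmod
      (fun N _ ↦ (isNewform0_exists_functional_equation_two_and N).1)
      (fun N _ ↦ (isNewform0_exists_functional_equation_two_and N).2))
  -- Gross–Zagier at `(N, E, K)`: `ord L(E) + ord L(E^{(d_K)}) ≤ 1`
  have hsum := analyticRank_add_le_one_of_isHeegnerPoint_of_not_isOfFinAddOrder hE (hGZ N W K)
    hK hH hP hnt
  -- bsd.S17 for `E` and for `E^{(d_K)}`, both in `C`, from Theorem A for `C`, `d ∉ {-3, -4}`
  have hd : (NumberField.discr K : ℚ) ≠ 0 := by exact_mod_cast NumberField.discr_ne_zero K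
  haveI := W.isElliptic_quadraticTwist hd
  obtain ⟨hrW, hsW⟩ :=
    rank_eq_analyticRank_of_thmA_on C hCvar hpar hWa hMM hE hGZ hHP hKo W hW (by omega)
  obtain ⟨hrd, hsd⟩ :=
    rank_eq_analyticRank_of_thmA_on C hCvar hpar hWa hMM hE hGZ hHP hKo
      (W.quadraticTwist (NumberField.discr K : ℚ)) (hCtw W _ hd hW) (by omega)
  -- the rank over `K`
  have hrk := mordellWeilRank_baseChange_quadratic_holds W K hK.1
  have hge : 1 ≤ (W.baseChange K).mordellWeilRank :=
    one_le_mordellWeilRank_of_not_isOfFinAddOrder _ (W.baseChange K).module_finite_point_holds hnt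
  exact ⟨by omega, shaFinite_baseChange_of_shaFinite W K hK.1 hsW hsd⟩

/-- `HasCM` is invariant under quadratic twists (same `j`-invariant: `j_quadraticTwist`,
`hasCM_iff_of_j_eq`). [cite: SilvermanAEC2009, III.1.4(b)] -/
theorem not_hasCM_quadraticTwist (W : WeierstrassCurve ℚ) [W.IsElliptic] {d : ℚ} (hd : d ≠ 0)
    (hCM : ¬ W.HasCM) : ¬ (W.quadraticTwist d).HasCM := by
  haveI := W.isElliptic_quadraticTwist hd
  rwa [hasCM_iff_of_j_eq (W.j_quadraticTwist hd)]

/-- **Kolyvagin's Theorem A for `E` without CM over `K = ℚ(i)` or `ℚ(√-3)`, reduced to the main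
case by quadratic twists** — the non-CM half of the leaf
`Kolyvagin1990_thmA_of_hasCM_or_discr N W K` (fields `K : Type`):
`mordellWeilRank_eq_one_and_shaFinite_of_thmA_on` for the class of non-CM curves (stable under
changes of variables and twists: `not_hasCM_variableChange`, `not_hasCM_quadraticTwist`), whose
Kolyvagin input is exactly the case treated in Gross 1991 (`E` non-CM, `d_K ∉ {-3, -4}`: Thm. 1.3
with §§2–10; in the tree `kolyvagin_of_Gross1991` / `kolyvagin_of_leaves` from
`Gross1991_prop_2_1`, `serre_open_image`, `Kolyvagin1990_sha_primary_finite`, the present leaf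
being vacuous there). [cite: McCallumLMS1991, §1 Theorem (Kolyvagin)]
[cite: GrossLMS1991, §1 Thm. 1.3 and §2] [cite: Darmon2004, Thm. 3.22 and §3.9] -/
theorem Kolyvagin1990_thmA_of_hasCM_or_discr_of_not_hasCM_of_mainCase (hCM : ¬ W.HasCM)
    (hmod : existsUnique_isNewformOf)
    (hWa : waldspurger_exists_heegnerField_twist_ne_zero)
    (hMM : murtyMurty_exists_heegnerField_twist_simpleZero)
    (hGZ : ∀ (N : ℕ) [NeZero N] (W : WeierstrassCurve ℚ) (K : Type) [Field K] [NumberField K],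
      gross_zagier N W K)
    (hHP : ∀ (W : WeierstrassCurve ℚ) (K : Type) [Field K] [NumberField K],
      exists_isHeegnerPoint W K)
    (hKo : ∀ (N : ℕ) [NeZero N] (W : WeierstrassCurve ℚ) (K : Type) [Field K] [NumberField K],
      ¬ W.HasCM → NumberField.discr K ≠ -3 ∧ NumberField.discr K ≠ -4 → kolyvagin N W K) :
    Kolyvagin1990_thmA_of_hasCM_or_discr N W K := by
  intro _ _ hK hH P hP hnt
  exact mordellWeilRank_eq_one_and_shaFinite_of_thmA_on (fun W ↦ ¬ W.HasCM)
    (fun W _ C' h ↦ not_hasCM_variableChange W C' h) (fun W _ _ hd h ↦ not_hasCM_quadraticTwist W hd h)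
    hmod hWa hMM hGZ hHP hKo hCM hK hH hP hnt

/-- **Kolyvagin's Theorem A for `d_K ∈ {-3, -4}` costs nothing beyond `d_K ∉ {-3, -4}`** (any `E`,
with or without CM; fields `K : Type`): the leaf `Kolyvagin1990_thmA_of_hasCM_or_discr N W K` from
`kolyvagin N' E' K'` at all instances with `d_{K'} ∉ {-3, -4}` (`hKo`) — Gross's standing
simplification *"for simplicity, we assume that `D ≠ 3, 4`"* (Gross 1991, §1) — and the analytic
named facts of Darmon's proof of Thm. 3.22 (`mordellWeilRank_eq_one_and_shaFinite_of_thmA_on` for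
the class of all curves). What the leaf still needs beyond the main case is therefore exactly
Theorem A for CM curves over fields with `𝒪_K^× = {±1}`.
[cite: McCallumLMS1991, §1 Theorem (Kolyvagin)] [cite: GrossLMS1991, §1 Thm. 1.3] -/
theorem Kolyvagin1990_thmA_of_hasCM_or_discr_of_thmA_discr_ne
    (hmod : existsUnique_isNewformOf)
    (hWa : waldspurger_exists_heegnerField_twist_ne_zero)
    (hMM : murtyMurty_exists_heegnerField_twist_simpleZero)
    (hGZ : ∀ (N : ℕ) [NeZero N] (W : WeierstrassCurve ℚ) (K : Type) [Field K] [NumberField K],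
      gross_zagier N W K)
    (hHP : ∀ (W : WeierstrassCurve ℚ) (K : Type) [Field K] [NumberField K],
      exists_isHeegnerPoint W K)
    (hKo : ∀ (N : ℕ) [NeZero N] (W : WeierstrassCurve ℚ) (K : Type) [Field K] [NumberField K],
      NumberField.discr K ≠ -3 ∧ NumberField.discr K ≠ -4 → kolyvagin N W K) :
    Kolyvagin1990_thmA_of_hasCM_or_discr N W K := by
  intro _ _ hK hH P hP hnt
  exact mordellWeilRank_eq_one_and_shaFinite_of_thmA_on (fun _ ↦ True) (fun _ _ _ _ ↦ trivial)
    (fun _ _ _ _ _ ↦ trivial) hmod hWa hMM hGZ hHP (fun N _ W K _ _ _ hD ↦ hKo N W K hD) trivial hK hH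
    hP hnt

/-- **Kolyvagin's theorem for ALL imaginary quadratic `K` from the fields with `d_K ∉ {-3, -4}`**
(fields `K : Type`): `kolyvagin N W K` at every instance follows from the instances with
`d_K ∉ {-3, -4}` and the analytic named facts of Darmon's proof of Thm. 3.22
(`Kolyvagin1990_thmA_of_hasCM_or_discr_of_thmA_discr_ne`). [cite: GrossLMS1991, §1 Thm. 1.3] -/
theorem kolyvagin_of_thmA_discr_ne
    (hmod : existsUnique_isNewformOf)
    (hWa : waldspurger_exists_heegnerField_twist_ne_zero)
    (hMM : murtyMurty_exists_heegnerField_twist_simpleZero)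
    (hGZ : ∀ (N : ℕ) [NeZero N] (W : WeierstrassCurve ℚ) (K : Type) [Field K] [NumberField K],
      gross_zagier N W K)
    (hHP : ∀ (W : WeierstrassCurve ℚ) (K : Type) [Field K] [NumberField K],
      exists_isHeegnerPoint W K)
    (hKo : ∀ (N : ℕ) [NeZero N] (W : WeierstrassCurve ℚ) (K : Type) [Field K] [NumberField K],
      NumberField.discr K ≠ -3 ∧ NumberField.discr K ≠ -4 → kolyvagin N W K) :
    kolyvagin N W K := by
  intro _ hK hH P hP hnt
  by_cases hD : NumberField.discr K ≠ -3 ∧ NumberField.discr K ≠ -4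
  · exact hKo N W K hD hK hH hP hnt
  · have hexc : W.HasCM ∨ NumberField.discr K = -3 ∨ NumberField.discr K = -4 := by
      right; by_contra h; push Not at h; exact hD h
    exact Kolyvagin1990_thmA_of_hasCM_or_discr_of_thmA_discr_ne hmod hWa hMM hGZ hHP hKo hexc hK hH
      hP hnt

/-- **The leaf from Theorem A under Gross's simplification `D ≠ 3, 4`, split as main case + CM
curves** (fields `K : Type`): `Kolyvagin1990_thmA_of_hasCM_or_discr N W K` from `kolyvagin` at the
main-case instances (`hKo`: `E'` non-CM, `d ∉ {-3, -4}`; Gross 1991) and at the instances `E'`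
with CM, `d ∉ {-3, -4}` (`hKoCM`: the genuinely remaining input, Kolyvagin 1990 [K1] for CM
curves / McCallum 1991, §3 "the general case is not significantly more difficult"), with the
analytic named facts. [cite: McCallumLMS1991, §1 Theorem (Kolyvagin) and §3]
[cite: GrossLMS1991, §1 Thm. 1.3 and §2] -/
theorem Kolyvagin1990_thmA_of_hasCM_or_discr_of_mainCase_of_hasCM_discr_ne
    (hmod : existsUnique_isNewformOf)
    (hWa : waldspurger_exists_heegnerField_twist_ne_zero)
    (hMM : murtyMurty_exists_heegnerField_twist_simpleZero)
    (hGZ : ∀ (N : ℕ) [NeZero N] (W : WeierstrassCurve ℚ) (K : Type) [Field K] [NumberField K],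
      gross_zagier N W K)
    (hHP : ∀ (W : WeierstrassCurve ℚ) (K : Type) [Field K] [NumberField K],
      exists_isHeegnerPoint W K)
    (hKo : ∀ (N : ℕ) [NeZero N] (W : WeierstrassCurve ℚ) (K : Type) [Field K] [NumberField K],
      ¬ W.HasCM → NumberField.discr K ≠ -3 ∧ NumberField.discr K ≠ -4 → kolyvagin N W K)
    (hKoCM : ∀ (N : ℕ) [NeZero N] (W : WeierstrassCurve ℚ) (K : Type) [Field K] [NumberField K],
      W.HasCM → NumberField.discr K ≠ -3 ∧ NumberField.discr K ≠ -4 → kolyvagin N W K) :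
    Kolyvagin1990_thmA_of_hasCM_or_discr N W K :=
  Kolyvagin1990_thmA_of_hasCM_or_discr_of_thmA_discr_ne hmod hWa hMM hGZ hHP fun N _ W K _ _ hD ↦ by
    by_cases hCM : W.HasCM
    · exact hKoCM N W K hCM hD
    · exact hKo N W K hCM hD

/-- **The leaf `Kolyvagin1990_thmA_of_hasCM_or_discr N W K` (fields `K : Type`) from its two
halves**: the non-CM half by the twist route
(`Kolyvagin1990_thmA_of_hasCM_or_discr_of_not_hasCM_of_mainCase`, main case of Theorem A + the
named facts of Darmon's proof of Thm. 3.22), and the CM half (`hCMcase`) — the only part still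
requiring Kolyvagin's Euler system beyond Gross's text (CM theory for the Galois image;
`Kolyvagin1990_thmA_of_hasCM_or_discr_of_localDataM` of `…ExceptionalPrimaryProofs` reduces it to
per-prime mod-`p^M` data). [cite: McCallumLMS1991, §1 Theorem (Kolyvagin)]
[cite: GrossLMS1991, §1 Thm. 1.3 and §2] -/
theorem Kolyvagin1990_thmA_of_hasCM_or_discr_of_mainCase_of_hasCM
    (hmod : existsUnique_isNewformOf)
    (hWa : waldspurger_exists_heegnerField_twist_ne_zero)
    (hMM : murtyMurty_exists_heegnerField_twist_simpleZero)
    (hGZ : ∀ (N : ℕ) [NeZero N] (W : WeierstrassCurve ℚ) (K : Type) [Field K] [NumberField K],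
      gross_zagier N W K)
    (hHP : ∀ (W : WeierstrassCurve ℚ) (K : Type) [Field K] [NumberField K],
      exists_isHeegnerPoint W K)
    (hKo : ∀ (N : ℕ) [NeZero N] (W : WeierstrassCurve ℚ) (K : Type) [Field K] [NumberField K],
      ¬ W.HasCM → NumberField.discr K ≠ -3 ∧ NumberField.discr K ≠ -4 → kolyvagin N W K)
    (hCMcase : W.HasCM → Kolyvagin1990_thmA_of_hasCM_or_discr N W K) :
    Kolyvagin1990_thmA_of_hasCM_or_discr N W K := by
  by_cases hCM : W.HasCM
  · exact hCMcase hCM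
  · exact Kolyvagin1990_thmA_of_hasCM_or_discr_of_not_hasCM_of_mainCase hCM hmod hWa hMM hGZ hHP hKo

/-- **Kolyvagin's theorem for all non-CM `E/ℚ` and ALL imaginary quadratic `K`** (fields
`K : Type`), from the main case: `kolyvagin N W K` for `E` without complex multiplication and
`d_K ∈ {-3, -4}` follows from the instances with `d_K ∉ {-3, -4}` (and the analytic named facts
of Darmon's proof of Thm. 3.22), by `Kolyvagin1990_thmA_of_hasCM_or_discr_of_not_hasCM_of_mainCase`.
So Gross's standing assumption "`D ≠ 3, 4`" (Gross 1991, §1) costs nothing for non-CM curves.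
[cite: GrossLMS1991, §1 Thm. 1.3] [cite: McCallumLMS1991, §1 Theorem (Kolyvagin)] -/
theorem kolyvagin_of_not_hasCM_of_mainCase (hCM : ¬ W.HasCM)
    (hmod : existsUnique_isNewformOf)
    (hWa : waldspurger_exists_heegnerField_twist_ne_zero)
    (hMM : murtyMurty_exists_heegnerField_twist_simpleZero)
    (hGZ : ∀ (N : ℕ) [NeZero N] (W : WeierstrassCurve ℚ) (K : Type) [Field K] [NumberField K],
      gross_zagier N W K)
    (hHP : ∀ (W : WeierstrassCurve ℚ) (K : Type) [Field K] [NumberField K],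
      exists_isHeegnerPoint W K)
    (hKo : ∀ (N : ℕ) [NeZero N] (W : WeierstrassCurve ℚ) (K : Type) [Field K] [NumberField K],
      ¬ W.HasCM → NumberField.discr K ≠ -3 ∧ NumberField.discr K ≠ -4 → kolyvagin N W K) :
    kolyvagin N W K := by
  intro _ hK hH P hP hnt
  by_cases hD : NumberField.discr K ≠ -3 ∧ NumberField.discr K ≠ -4
  · exact hKo N W K hCM hD hK hH hP hnt
  · have hexc : W.HasCM ∨ NumberField.discr K = -3 ∨ NumberField.discr K = -4 := by
      right; by_contra h; push Not at h; exact hD h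
    exact Kolyvagin1990_thmA_of_hasCM_or_discr_of_not_hasCM_of_mainCase hCM hmod hWa hMM hGZ hHP
      hKo hexc hK hH hP hnt

/-- **The `p`-primary leaf at `d_K ∈ {-3, -4}` for non-CM `E`, from the main case**: for `E`
without CM and every imaginary quadratic `K : Type`, `Kolyvagin1990_sha_primary_finite N W K`
(each `Ш(E/K)[p^∞]` finite when `y_K` has infinite order) follows from the main case and the
analytic named facts, `Ш(E/K)` being finite by `kolyvagin_of_not_hasCM_of_mainCase`. This grounds
in the main case the non-CM part of the residual that `HeegnerPointsKolyvaginPrimaryLeavesProofs`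
(`Kolyvagin1990_sha_primary_finite_of_leavesM_of_thmA`) draws from the present leaf.
[cite: GrossLMS1991, §1 Thm. 1.3 (2) and §2] [cite: McCallumLMS1991, §1 Theorem (Kolyvagin)] -/
theorem Kolyvagin1990_sha_primary_finite_of_not_hasCM_of_mainCase (hCM : ¬ W.HasCM)
    (hmod : existsUnique_isNewformOf)
    (hWa : waldspurger_exists_heegnerField_twist_ne_zero)
    (hMM : murtyMurty_exists_heegnerField_twist_simpleZero)
    (hGZ : ∀ (N : ℕ) [NeZero N] (W : WeierstrassCurve ℚ) (K : Type) [Field K] [NumberField K],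
      gross_zagier N W K)
    (hHP : ∀ (W : WeierstrassCurve ℚ) (K : Type) [Field K] [NumberField K],
      exists_isHeegnerPoint W K)
    (hKo : ∀ (N : ℕ) [NeZero N] (W : WeierstrassCurve ℚ) (K : Type) [Field K] [NumberField K],
      ¬ W.HasCM → NumberField.discr K ≠ -3 ∧ NumberField.discr K ≠ -4 → kolyvagin N W K) :
    Kolyvagin1990_sha_primary_finite N W K := by
  intro _ hK hH P hP hnt p _hp
  haveI : Finite (W.baseChange K).sha :=
    (kolyvagin_of_not_hasCM_of_mainCase hCM hmod hWa hMM hGZ hHP hKo hK hH hP hnt).2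
  exact Set.toFinite _

end Leaf

/-! ## §D. Down to Gross's leaves: the non-CM half from `Gross1991_prop_2_1`, Serre and the
`p`-primary leaf at main-case instances -/

section GrossLeaves

open ModularForms

/-- **Theorem A in the main case, instance by instance, from Gross's leaves**: for `E` without CM
and `d_K ∉ {-3, -4}`, `kolyvagin N E K` follows from Prop. 2.1 (`h21`, Gross 1991 §§3–10),
Serre's open image theorem (`hS`) and the finiteness of the `Ш(E/K)[p^∞]` (`hC`, Kolyvagin's
refinement) **at that same main-case instance** — the tree's
`mordellWeilRank_eq_one_and_shaFinite_of_prop_2_1`; no instance of the present leaf enters.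
[cite: GrossLMS1991, §1 Thm. 1.3 and §2 (Prop. 2.1)] -/
theorem kolyvagin_mainCase_of_Gross1991
    (h21 : ∀ (N : ℕ) [NeZero N] (W : WeierstrassCurve ℚ) (K : Type) [Field K] [NumberField K],
      Gross1991_prop_2_1 N W K)
    (hS : serre_open_image)
    (hC : ∀ (N : ℕ) [NeZero N] (W : WeierstrassCurve ℚ) (K : Type) [Field K] [NumberField K],
      ¬ W.HasCM → NumberField.discr K ≠ -3 ∧ NumberField.discr K ≠ -4 →
        Kolyvagin1990_sha_primary_finite N W K)
    (N : ℕ) [NeZero N] (W : WeierstrassCurve ℚ) (K : Type) [Field K] [NumberField K]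
    (hCM : ¬ W.HasCM) (hD : NumberField.discr K ≠ -3 ∧ NumberField.discr K ≠ -4) :
    kolyvagin N W K := by
  intro _ hK hH P hP hnt
  exact mordellWeilRank_eq_one_and_shaFinite_of_prop_2_1 N W K (h21 N W K) hS (hC N W K hCM hD)
    hCM hK hD hH hP hnt

variable {N : ℕ} [NeZero N] {W : WeierstrassCurve ℚ} {K : Type} [Field K] [NumberField K]

/-- **The non-CM half of the leaf from Gross's leaves AT MAIN-CASE INSTANCES ONLY.** For `E/ℚ`
without complex multiplication and any imaginary quadratic `K : Type` (so, within the leaf,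
`K = ℚ(i)` or `ℚ(√-3)`): `Kolyvagin1990_thmA_of_hasCM_or_discr N W K` follows from
* `Gross1991_prop_2_1` (`h21`; it carries Gross's standing hypotheses `¬ CM`, `d ∉ {-3, -4}` as
  binders, so only main-case content is asserted), Serre's open image theorem (`hS`) and
  Kolyvagin's `Ш[p^∞]`-finiteness `Kolyvagin1990_sha_primary_finite` **at instances `(N', E', K')`
  with `E'` non-CM and `d_{K'} ∉ {-3, -4}`** (`hC`) — through `kolyvagin_mainCase_of_Gross1991`;
* modularity (`hmod`), Waldspurger (`hWa`), Murty–Murty (`hMM`), Gross–Zagier (`hGZ`) and the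
  `K`-rationality of Heegner points (`hHP`) — the named inputs of Darmon's proof of Thm. 3.22;
by the twist route `Kolyvagin1990_thmA_of_hasCM_or_discr_of_not_hasCM_of_mainCase`. In particular
the reduction is not circular with `HeegnerPointsKolyvaginPrimaryLeavesProofs`, which feeds the
CM / `d_K ∈ {-3, -4}` instances of `Kolyvagin1990_sha_primary_finite` from this leaf: those
instances are not used here. [cite: McCallumLMS1991, §1 Theorem (Kolyvagin)]
[cite: GrossLMS1991, §1 Thm. 1.3, §2 Prop. 2.1] [cite: Darmon2004, Thm. 3.22 and §3.9] -/
theorem Kolyvagin1990_thmA_of_hasCM_or_discr_of_not_hasCM_of_Gross1991 (hCM : ¬ W.HasCM)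
    (h21 : ∀ (N : ℕ) [NeZero N] (W : WeierstrassCurve ℚ) (K : Type) [Field K] [NumberField K],
      Gross1991_prop_2_1 N W K)
    (hS : serre_open_image)
    (hC : ∀ (N : ℕ) [NeZero N] (W : WeierstrassCurve ℚ) (K : Type) [Field K] [NumberField K],
      ¬ W.HasCM → NumberField.discr K ≠ -3 ∧ NumberField.discr K ≠ -4 →
        Kolyvagin1990_sha_primary_finite N W K)
    (hmod : existsUnique_isNewformOf)
    (hWa : waldspurger_exists_heegnerField_twist_ne_zero)
    (hMM : murtyMurty_exists_heegnerField_twist_simpleZero)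
    (hGZ : ∀ (N : ℕ) [NeZero N] (W : WeierstrassCurve ℚ) (K : Type) [Field K] [NumberField K],
      gross_zagier N W K)
    (hHP : ∀ (W : WeierstrassCurve ℚ) (K : Type) [Field K] [NumberField K],
      exists_isHeegnerPoint W K) :
    Kolyvagin1990_thmA_of_hasCM_or_discr N W K :=
  Kolyvagin1990_thmA_of_hasCM_or_discr_of_not_hasCM_of_mainCase hCM hmod hWa hMM hGZ hHP
    (fun N _ W K _ _ hCM' hD ↦ kolyvagin_mainCase_of_Gross1991 h21 hS hC N W K hCM' hD)

end GrossLeaves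

/-! ## §E. The CM half: Coates–Wiles–Rubin in analytic rank `0`, so that Theorem A is only needed
for CM curves of analytic rank `1` over Waldspurger fields with `d ∉ {-3, -4}` -/

section CMHalf

open ModularForms WeierstrassCurve.QuadraticDescent

/-- **Analytic rank `0` for CM curves without Kolyvagin** (Coates–Wiles 1977, Thm. 1, with
Arthaud / Rubin for general CM; Rubin 1987, Remark (3) to Thm. A): if `E/ℚ` has complex
multiplication and `ord_{s=1} L(E, s) = 0`, i.e. `L(E, 1) ≠ 0` (modularity, `hE`), then `E(ℚ)`
is finite (`hCW`, tree fact `finite_point_of_hasCM_of_L_one_ne_zero`), so `rank E(ℚ) = 0`, and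
`Ш(E/ℚ)` is finite (`hRu`, tree fact `shaFinite_of_hasCM_of_L_one_ne_zero`).
[cite: CoatesWiles1977, Thm 1] [cite: Rubin1987Sha, Thm. A (p. 527) and §0 Remark (3) (p. 528)] -/
theorem mordellWeilRank_eq_zero_and_shaFinite_of_hasCM_of_analyticRank_eq_zero
    (hE : hasEntireLFunction_rat) (hCW : finite_point_of_hasCM_of_L_one_ne_zero)
    (hRu : shaFinite_of_hasCM_of_L_one_ne_zero) (W : WeierstrassCurve ℚ) [W.IsElliptic]
    (hCM : W.HasCM) (h0 : W.analyticRank = 0) : W.mordellWeilRank = 0 ∧ W.ShaFinite := by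
  have hL : W.entireLFunction 1 ≠ 0 := (W.analyticRank_eq_zero_iff_holds (hE W)).mp h0
  exact ⟨mordellWeilRank_eq_zero_of_finite W (hCW W hCM hL), hRu W hCM hL⟩

/-- `HasCM` is invariant under admissible changes of variables. [cite: SilvermanAEC2009, III.1.4(b)] -/
theorem hasCM_variableChange (W : WeierstrassCurve ℚ) [W.IsElliptic] (C' : VariableChange ℚ)
    (hCM : W.HasCM) : (C' • W).HasCM := by
  rwa [hasCM_iff_of_j_eq (W.variableChange_j C')]

/-- `HasCM` is invariant under quadratic twists. [cite: SilvermanAEC2009, III.1.4(b)] -/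
theorem hasCM_quadraticTwist (W : WeierstrassCurve ℚ) [W.IsElliptic] {d : ℚ} (hd : d ≠ 0)
    (hCM : W.HasCM) : (W.quadraticTwist d).HasCM := by
  haveI := W.isElliptic_quadraticTwist hd
  rwa [hasCM_iff_of_j_eq (W.j_quadraticTwist hd)]

/-- **bsd.S17 for CM curves from Coates–Wiles–Rubin (rank `0`) and Kolyvagin's Theorem A for CM
curves of analytic rank `1` over Waldspurger fields with `d ∉ {-3, -4}` (rank `1`).** For `E/ℚ`
with CM and `ord_{s=1} L(E, s) ≤ 1`: `rank E(ℚ) = ord` and `Ш(E/ℚ)` is finite, from modularity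
(`hmod`), Waldspurger (`hWa`), Gross–Zagier (`hGZ`), Heegner points over `K` (`hHP`),
Coates–Wiles (`hCW`), Rubin 1987 (`hRu`) and Theorem A **only at instances `(N_{E'}, E', K')`
with `E'` CM and globally minimal of analytic rank `1`, `d_{K'} ∉ {-3, -4}` and
`L(E'^{(d_{K'})}, 1) ≠ 0`** (`hKo1`; Kolyvagin 1990 for CM curves — the configuration of
Kolyvagin's original theorem, `ord L(E'/K') = 1`). Reduction to a globally minimal model as in
`rank_eq_analyticRank_of_thmA_on`. [cite: Darmon2004, Thm. 3.22 and §3.9]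
[cite: CoatesWiles1977, Thm 1] [cite: Rubin1987Sha, §0 Remark (3) (p. 528)] -/
theorem rank_eq_analyticRank_of_hasCM_of_thmA_cm_rankOne
    (hmod : existsUnique_isNewformOf)
    (hWa : waldspurger_exists_heegnerField_twist_ne_zero)
    (hGZ : ∀ (N : ℕ) [NeZero N] (W : WeierstrassCurve ℚ) (K : Type) [Field K] [NumberField K],
      gross_zagier N W K)
    (hHP : ∀ (W : WeierstrassCurve ℚ) (K : Type) [Field K] [NumberField K],
      exists_isHeegnerPoint W K)
    (hCW : finite_point_of_hasCM_of_L_one_ne_zero) (hRu : shaFinite_of_hasCM_of_L_one_ne_zero)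
    (hKo1 : ∀ (N : ℕ) [NeZero N] (W : WeierstrassCurve ℚ) (K : Type) [Field K] [NumberField K],
      W.HasCM → W.analyticRank = 1 → NumberField.discr K ≠ -3 ∧ NumberField.discr K ≠ -4 →
        (W.quadraticTwist (NumberField.discr K : ℚ)).entireLFunction 1 ≠ 0 → kolyvagin N W K)
    (W : WeierstrassCurve ℚ) [W.IsElliptic] (hCM : W.HasCM) (h : W.analyticRank ≤ 1) :
    W.mordellWeilRank = W.analyticRank ∧ W.ShaFinite := by
  have hE : hasEntireLFunction_rat := WeierstrassCurve.hasEntireLFunction_rat_of_modularity hmod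
  rcases Nat.le_one_iff_eq_zero_or_eq_one.mp h with h0 | h1
  · rw [h0]
    exact mordellWeilRank_eq_zero_and_shaFinite_of_hasCM_of_analyticRank_eq_zero hE hCW hRu W hCM h0
  · have hpar : ∀ W : WeierstrassCurve ℚ, W.even_analyticRank_iff := fun W ↦
      W.even_analyticRank_iff_of hE (W.hasFunctionalEquationSign_rootNumber_of_modularity hmod
        (fun N _ ↦ (isNewform0_exists_functional_equation_two_and N).1)
        (fun N _ ↦ (isNewform0_exists_functional_equation_two_and N).2))
    -- globally minimal model
    obtain ⟨C', hC'⟩ := hasGlobalMinimalModel_rat_holds W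
    haveI := hC'
    have hanC : (C' • W).analyticRank = W.analyticRank := analyticRank_variableChange_holds W C'
    have h1' : (C' • W).analyticRank = 1 := by rw [hanC, h1]
    obtain ⟨hr, hs⟩ := mordellWeilRank_eq_one_of_isGloballyMinimal_of_thmA_on_waldspurger
      (fun W ↦ W.HasCM ∧ W.analyticRank = 1) hpar hWa hE hGZ hHP
      (fun N _ W K _ _ hW hD hL ↦ hKo1 N W K hW.1 hW.2 hD hL) (C' • W)
      ⟨hasCM_variableChange W C' hCM, h1'⟩ h1'
    have hrkC : (C' • W).mordellWeilRank = W.mordellWeilRank := mordellWeilRank_variableChange_holds W C'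
    refine ⟨?_, (shaFinite_variableChange_iff_holds W C').mp hs⟩
    rw [← hrkC, hr, h1]

variable {N : ℕ} [NeZero N] {W : WeierstrassCurve ℚ} {K : Type} [Field K] [NumberField K]

/-- **The CM half of the leaf, reduced by twists to Coates–Wiles–Rubin and Kolyvagin for CM curves
of analytic rank `1` over Waldspurger fields with `d ∉ {-3, -4}`.** Let `E/ℚ` have CM, `K` any
imaginary quadratic field with the Heegner hypothesis for `N` (within the leaf: CM is the case
excluded by Gross 1991, §2, for every `K`), `P = y_K` a Heegner point of level `N` of infinite
order. Then `rank E(K) = 1` and `Ш(E/K)` is finite: Gross–Zagier at `(N, E, K)` gives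
`ord L(E) + ord L(E^{(d_K)}) ≤ 1`; `E` and `E^{(d_K)}` have CM, so
`rank_eq_analyticRank_of_hasCM_of_thmA_cm_rankOne` applies to both (the analytic-rank-`0` one by
Coates–Wiles–Rubin, the other — if of analytic rank `1` — by Theorem A over an auxiliary
Waldspurger field); then `rank E(K) = rank E(ℚ) + rank E^{(d_K)}(ℚ) = 1` and `Ш(E/K)` is finite
by §A. [cite: McCallumLMS1991, §1 Theorem (Kolyvagin)] [cite: GrossLMS1991, §1 Thm. 1.3 and §2]
[cite: CoatesWiles1977, Thm 1] [cite: Rubin1987Sha, §0 Remark (3) (p. 528)] -/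
theorem Kolyvagin1990_thmA_of_hasCM_or_discr_of_hasCM_of_thmA_cm_rankOne (hCM : W.HasCM)
    (hmod : existsUnique_isNewformOf)
    (hWa : waldspurger_exists_heegnerField_twist_ne_zero)
    (hGZ : ∀ (N : ℕ) [NeZero N] (W : WeierstrassCurve ℚ) (K : Type) [Field K] [NumberField K],
      gross_zagier N W K)
    (hHP : ∀ (W : WeierstrassCurve ℚ) (K : Type) [Field K] [NumberField K],
      exists_isHeegnerPoint W K)
    (hCW : finite_point_of_hasCM_of_L_one_ne_zero) (hRu : shaFinite_of_hasCM_of_L_one_ne_zero)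
    (hKo1 : ∀ (N : ℕ) [NeZero N] (W : WeierstrassCurve ℚ) (K : Type) [Field K] [NumberField K],
      W.HasCM → W.analyticRank = 1 → NumberField.discr K ≠ -3 ∧ NumberField.discr K ≠ -4 →
        (W.quadraticTwist (NumberField.discr K : ℚ)).entireLFunction 1 ≠ 0 → kolyvagin N W K) :
    Kolyvagin1990_thmA_of_hasCM_or_discr N W K := by
  intro _ _ hK hH P hP hnt
  haveI : (W.baseChange K).IsElliptic := by rw [baseChange]; infer_instance
  have hE : hasEntireLFunction_rat := WeierstrassCurve.hasEntireLFunction_rat_of_modularity hmod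
  -- Gross–Zagier at `(N, E, K)`: `ord L(E) + ord L(E^{(d_K)}) ≤ 1`
  have hsum := analyticRank_add_le_one_of_isHeegnerPoint_of_not_isOfFinAddOrder hE (hGZ N W K)
    hK hH hP hnt
  -- bsd.S17 for the CM curves `E` and `E^{(d_K)}`
  have hd : (NumberField.discr K : ℚ) ≠ 0 := by exact_mod_cast NumberField.discr_ne_zero K
  haveI := W.isElliptic_quadraticTwist hd
  obtain ⟨hrW, hsW⟩ :=
    rank_eq_analyticRank_of_hasCM_of_thmA_cm_rankOne hmod hWa hGZ hHP hCW hRu hKo1 W hCM (by omega)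
  obtain ⟨hrd, hsd⟩ :=
    rank_eq_analyticRank_of_hasCM_of_thmA_cm_rankOne hmod hWa hGZ hHP hCW hRu hKo1
      (W.quadraticTwist (NumberField.discr K : ℚ)) (hasCM_quadraticTwist W hd hCM) (by omega)
  -- the rank over `K`, and `Ш(E/K)`
  have hrk := mordellWeilRank_baseChange_quadratic_holds W K hK.1
  have hge : 1 ≤ (W.baseChange K).mordellWeilRank :=
    one_le_mordellWeilRank_of_not_isOfFinAddOrder _ (W.baseChange K).module_finite_point_holds hnt
  exact ⟨by omega, shaFinite_baseChange_of_shaFinite W K hK.1 hsW hsd⟩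

/-- **The leaf `Kolyvagin1990_thmA_of_hasCM_or_discr N W K` (fields `K : Type`) from the main
case, Coates–Wiles–Rubin, and Kolyvagin for CM curves of analytic rank `1`.** Inputs, all named
facts of the tree stating printed theorems, except the last:
* `hKo` — Theorem A in the main case (`E'` non-CM, `d ∉ {-3, -4}`: Gross 1991; in the tree from
  `Gross1991_prop_2_1`, `serre_open_image`, `Kolyvagin1990_sha_primary_finite`, cf.
  `kolyvagin_mainCase_of_Gross1991`);
* `hmod`, `hWa`, `hMM`, `hGZ`, `hHP` — modularity, Waldspurger, Murty–Murty, Gross–Zagier, Heegner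
  points over `K`;
* `hCW`, `hRu` — Coates–Wiles 1977 and Rubin 1987 (CM, `L(E, 1) ≠ 0`);
* `hKo1` — Theorem A for CM curves `E'` (globally minimal, analytic rank `1`) over `K'` with
  `d_{K'} ∉ {-3, -4}` and `L(E'^{(d_{K'})}, 1) ≠ 0`: **the irreducible remainder of the leaf**
  (Kolyvagin 1990, [K1], for CM curves; McCallum 1991, §3: "the general case is not significantly
  more difficult").
[cite: McCallumLMS1991, §1 Theorem (Kolyvagin) and §3] [cite: GrossLMS1991, §1 Thm. 1.3 and §2]
[cite: CoatesWiles1977, Thm 1] [cite: Rubin1987Sha, §0 Remark (3) (p. 528)] -/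
theorem Kolyvagin1990_thmA_of_hasCM_or_discr_of_mainCase_of_thmA_cm_rankOne
    (hmod : existsUnique_isNewformOf)
    (hWa : waldspurger_exists_heegnerField_twist_ne_zero)
    (hMM : murtyMurty_exists_heegnerField_twist_simpleZero)
    (hGZ : ∀ (N : ℕ) [NeZero N] (W : WeierstrassCurve ℚ) (K : Type) [Field K] [NumberField K],
      gross_zagier N W K)
    (hHP : ∀ (W : WeierstrassCurve ℚ) (K : Type) [Field K] [NumberField K],
      exists_isHeegnerPoint W K)
    (hKo : ∀ (N : ℕ) [NeZero N] (W : WeierstrassCurve ℚ) (K : Type) [Field K] [NumberField K],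
      ¬ W.HasCM → NumberField.discr K ≠ -3 ∧ NumberField.discr K ≠ -4 → kolyvagin N W K)
    (hCW : finite_point_of_hasCM_of_L_one_ne_zero) (hRu : shaFinite_of_hasCM_of_L_one_ne_zero)
    (hKo1 : ∀ (N : ℕ) [NeZero N] (W : WeierstrassCurve ℚ) (K : Type) [Field K] [NumberField K],
      W.HasCM → W.analyticRank = 1 → NumberField.discr K ≠ -3 ∧ NumberField.discr K ≠ -4 →
        (W.quadraticTwist (NumberField.discr K : ℚ)).entireLFunction 1 ≠ 0 → kolyvagin N W K) :
    Kolyvagin1990_thmA_of_hasCM_or_discr N W K := by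
  by_cases hCM : W.HasCM
  · exact Kolyvagin1990_thmA_of_hasCM_or_discr_of_hasCM_of_thmA_cm_rankOne hCM hmod hWa hGZ hHP hCW
      hRu hKo1
  · exact Kolyvagin1990_thmA_of_hasCM_or_discr_of_not_hasCM_of_mainCase hCM hmod hWa hMM hGZ hHP hKo

end CMHalf

/-! ## §F. Consequences for `kolyvagin` and bsd.S17 -/

section Consequences

open ModularForms

variable {N : ℕ} [NeZero N] {W : WeierstrassCurve ℚ} {K : Type} [Field K] [NumberField K]

/-- **Kolyvagin's theorem at every instance (fields `K : Type`) from the main case,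
Coates–Wiles–Rubin, the analytic named facts, and Theorem A for CM curves of analytic rank `1`
over Waldspurger fields with `d ∉ {-3, -4}`**: at a main-case instance this is `hKo`; every other
instance is an instance of the leaf, `Kolyvagin1990_thmA_of_hasCM_or_discr_of_mainCase_of_thmA_cm_rankOne`.
[cite: McCallumLMS1991, §1 Theorem (Kolyvagin)] [cite: GrossLMS1991, §1 Thm. 1.3 and §2] -/
theorem kolyvagin_of_mainCase_of_thmA_cm_rankOne
    (hmod : existsUnique_isNewformOf)
    (hWa : waldspurger_exists_heegnerField_twist_ne_zero)
    (hMM : murtyMurty_exists_heegnerField_twist_simpleZero)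
    (hGZ : ∀ (N : ℕ) [NeZero N] (W : WeierstrassCurve ℚ) (K : Type) [Field K] [NumberField K],
      gross_zagier N W K)
    (hHP : ∀ (W : WeierstrassCurve ℚ) (K : Type) [Field K] [NumberField K],
      exists_isHeegnerPoint W K)
    (hKo : ∀ (N : ℕ) [NeZero N] (W : WeierstrassCurve ℚ) (K : Type) [Field K] [NumberField K],
      ¬ W.HasCM → NumberField.discr K ≠ -3 ∧ NumberField.discr K ≠ -4 → kolyvagin N W K)
    (hCW : finite_point_of_hasCM_of_L_one_ne_zero) (hRu : shaFinite_of_hasCM_of_L_one_ne_zero)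
    (hKo1 : ∀ (N : ℕ) [NeZero N] (W : WeierstrassCurve ℚ) (K : Type) [Field K] [NumberField K],
      W.HasCM → W.analyticRank = 1 → NumberField.discr K ≠ -3 ∧ NumberField.discr K ≠ -4 →
        (W.quadraticTwist (NumberField.discr K : ℚ)).entireLFunction 1 ≠ 0 → kolyvagin N W K) :
    kolyvagin N W K := by
  intro _ hK hH P hP hnt
  by_cases hmain : ¬ W.HasCM ∧ NumberField.discr K ≠ -3 ∧ NumberField.discr K ≠ -4
  · exact hKo N W K hmain.1 hmain.2 hK hH hP hnt
  · have hexc : W.HasCM ∨ NumberField.discr K = -3 ∨ NumberField.discr K = -4 := by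
      by_contra h
      push Not at h
      exact hmain ⟨h.1, h.2.1, h.2.2⟩
    exact Kolyvagin1990_thmA_of_hasCM_or_discr_of_mainCase_of_thmA_cm_rankOne hmod hWa hMM hGZ hHP
      hKo hCW hRu hKo1 hexc hK hH hP hnt

/-- **bsd.S17 (`rank_eq_analyticRank_of_analyticRank_le_one`: Gross–Zagier–Kolyvagin over `ℚ`)
from the main case of Theorem A, Coates–Wiles–Rubin, the analytic named facts, and Theorem A for
CM curves of analytic rank `1` over Waldspurger fields with `d ∉ {-3, -4}`** — compare
`rank_eq_analyticRank_of_analyticRank_le_one_of_modularity''` (`HeegnerPointReflectionHolds`),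
whose Kolyvagin input ranges over all `(E, K)`: here the CM / `d_K ∈ {-3, -4}` instances outside
the analytic-rank-`1` CM configuration are not needed. By cases:
`rank_eq_analyticRank_of_not_hasCM_of_mainCase`, `rank_eq_analyticRank_of_hasCM_of_thmA_cm_rankOne`.
[cite: Darmon2004, Thm. 3.22 and §3.9] [cite: GrossLMS1991, §1 Thm. 1.3 and §2]
[cite: CoatesWiles1977, Thm 1] [cite: Rubin1987Sha, §0 Remark (3) (p. 528)] -/
theorem rank_eq_analyticRank_of_analyticRank_le_one_of_mainCase_of_thmA_cm_rankOne
    (hmod : existsUnique_isNewformOf)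
    (hWa : waldspurger_exists_heegnerField_twist_ne_zero)
    (hMM : murtyMurty_exists_heegnerField_twist_simpleZero)
    (hGZ : ∀ (N : ℕ) [NeZero N] (W : WeierstrassCurve ℚ) (K : Type) [Field K] [NumberField K],
      gross_zagier N W K)
    (hHP : ∀ (W : WeierstrassCurve ℚ) (K : Type) [Field K] [NumberField K],
      exists_isHeegnerPoint W K)
    (hKo : ∀ (N : ℕ) [NeZero N] (W : WeierstrassCurve ℚ) (K : Type) [Field K] [NumberField K],
      ¬ W.HasCM → NumberField.discr K ≠ -3 ∧ NumberField.discr K ≠ -4 → kolyvagin N W K)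
    (hCW : finite_point_of_hasCM_of_L_one_ne_zero) (hRu : shaFinite_of_hasCM_of_L_one_ne_zero)
    (hKo1 : ∀ (N : ℕ) [NeZero N] (W : WeierstrassCurve ℚ) (K : Type) [Field K] [NumberField K],
      W.HasCM → W.analyticRank = 1 → NumberField.discr K ≠ -3 ∧ NumberField.discr K ≠ -4 →
        (W.quadraticTwist (NumberField.discr K : ℚ)).entireLFunction 1 ≠ 0 → kolyvagin N W K) :
    rank_eq_analyticRank_of_analyticRank_le_one := by
  intro W _ h
  by_cases hCM : W.HasCM
  · exact rank_eq_analyticRank_of_hasCM_of_thmA_cm_rankOne hmod hWa hGZ hHP hCW hRu hKo1 W hCM h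
  · have hE : hasEntireLFunction_rat := WeierstrassCurve.hasEntireLFunction_rat_of_modularity hmod
    have hpar : ∀ W : WeierstrassCurve ℚ, W.even_analyticRank_iff := fun W ↦
      W.even_analyticRank_iff_of hE (W.hasFunctionalEquationSign_rootNumber_of_modularity hmod
        (fun N _ ↦ (isNewform0_exists_functional_equation_two_and N).1)
        (fun N _ ↦ (isNewform0_exists_functional_equation_two_and N).2))
    exact rank_eq_analyticRank_of_not_hasCM_of_mainCase hpar hWa hMM hE hGZ hHP hKo W hCM h

end Consequences

end Literature.NumberTheory.EllipticCurves

end
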